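import Literature.Computability.FineGrained.MinPlusToNegativeTriangleSweepSteps
import HarnessLib

/-!
# Distance product `≤₃` Negative Triangle: setup, fill, update, decoding and the blocks of a triple

Symbolic execution of the remaining straight-line blocks and counted loops of the cell-sweep
product step `NegTriSweep.psNT`
(`Literature.Computability.FineGrained.MinPlusToNegativeTriangleSweepProgram`; Vassilevska
Williams–Williams, J. ACM 65 (2018), Thm. 4.2): the bit length (`bitlen_spec`), the three setup
blocks establishing the constant registers `Regs` (`setup_spec`), the fill of the query matrix with
non-edges (`fill_spec`), the dyadic end-of-round update of the lower bounds (`loUpd_spec`), the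
decoding of the searched values into the codes of `X ⋆ Y` (`decode_spec`), the register blocks of a
block triple and of a cell probe (`tripleOps1_spec`, `tripleOps2_spec`, `tripleOps3_spec`,
`cellOps_spec`), the marking of a found pair (`markOps_spec`) and the oracle query (`ask_exec`).

## References

* V. Vassilevska Williams, R. R. Williams, *Subcubic equivalences between path, matrix, and
  triangle problems*, J. ACM 65 (2018), Art. 27, Thm. 4.2 (p. 27:14; proof pp. 27:17–18).
* T. Nipkow, G. Klein, *Concrete Semantics with Isabelle/HOL*, Springer 2014, §7, §12.
-/

namespace Literature.Computability.FineGrained.NegTriSweep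

open Cryptography Cryptography.WordRAM Cryptography.WordRAM.SProg APSPPower NegTriStep

set_option linter.unusedSimpArgs false

/-! ## Elementary facts about the parameters -/

/-- `size n ≤ n`. [folklore] -/
theorem size_le_self (n : ℕ) : Nat.size n ≤ n := Nat.size_le.2 Nat.lt_two_pow_self

/-- `1 ≤ L`. [folklore] -/
theorem one_le_cL (n : ℕ) : 1 ≤ cL n := Nat.one_le_two_pow

/-- `1 ≤ M`. [folklore] -/
theorem one_le_cM (c n : ℕ) : 1 ≤ cM c n := Nat.one_le_two_pow

/-! ## Bit length -/

/-- **Semantics of `bitlen`**: `r20 := size n`, `r70 := 0`, in `4 size n + 3` steps. [folklore] -/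
theorem bitlen_spec {w : ℕ} {O : List ℕ → List ℕ} {n : ℕ} {S H : ℕ → ℕ} {qs : List (List ℕ)}
    (h2 : S 2 = n) (hnw : n < 2 ^ w) :
    ∃ S', ExecLE w O bitlen ⟨merge S H, qs⟩ ⟨merge S' H, qs⟩ (4 * Nat.size n + 3) ∧
      (∀ i, i ≠ 20 → i ≠ 70 → S' i = S i) ∧ S' 20 = Nat.size n ∧ S' 70 = 0 := by
  have hsz : Nat.size n ≤ n := size_le_self n
  -- the two initial assignments
  obtain ⟨st₁, hex₁, S₁, rfl, hS₁, h20₁, h70₁⟩ : ∃ st₁, Exec w O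
      (block [(.add, .dir 20, .imm 0, .imm 0), (.add, .dir 70, .dir 2, .imm 0)]) ⟨merge S H, qs⟩ st₁ 2 ∧
      ∃ S₁, st₁ = ⟨merge S₁ H, qs⟩ ∧ (∀ i, i ≠ 20 → i ≠ 70 → S₁ i = S i) ∧ S₁ 20 = 0 ∧ S₁ 70 = n := by
    refine Exec.block_of_fwd _ _ fun R hR => ?_
    have htmp := execOps_cons_fwd hR; clear hR; obtain ⟨v1, hv1, hR⟩ := htmp
    simp -failIfUnchanged (disch := omega) only [Operand.write, Operand.read, merge_apply_of_lt,
          merge_apply_of_le, Function.update_self, Function.update_of_ne, update_merge_of_lt,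
          update_merge_of_le, Nat.add_zero, Nat.zero_add, BinOp.eval_mod, BinOp.eval_eq, BinOp.eval_band,
          BinOp.eval_shr, BinOp.eval_div, BinOp.eval_lt, BinOp.eval_add_of_lt, BinOp.eval_sub_of_le,
          BinOp.eval_mul_of_lt, h2] at hv1 hR
    have htmp := execOps_cons_fwd hR; clear hR; obtain ⟨v2, hv2, hR⟩ := htmp
    simp -failIfUnchanged (disch := omega) only [Operand.write, Operand.read, merge_apply_of_lt,
          merge_apply_of_le, Function.update_self, Function.update_of_ne, update_merge_of_lt,
          update_merge_of_le, Nat.add_zero, Nat.zero_add, BinOp.eval_mod, BinOp.eval_eq, BinOp.eval_band,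
          BinOp.eval_shr, BinOp.eval_div, BinOp.eval_lt, BinOp.eval_add_of_lt, BinOp.eval_sub_of_le,
          BinOp.eval_mul_of_lt, h2] at hv2 hR
    simp only [execOps_nil] at hR; subst hR; subst hv1 hv2
    exact ⟨_, rfl, fun i h20 h70 => by simp [Function.update_of_ne, h20, h70], by simp, by simp⟩
  -- the loop: after `i` iterations `r70 = n / 2^i`, `r20 = i`
  obtain ⟨st', hex, S', rfl, hS', h20', h70'⟩ := ExecLE.whilenz_invariant (w := w) (O := O)
    (x := .dir 70) (s := block [(.div, .dir 70, .dir 70, .imm 2), (.add, .dir 20, .dir 20, .imm 1)])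
    (Nat.size n) 2
    (fun i st => ∃ S', st = ⟨merge S' H, qs⟩ ∧ (∀ j, j ≠ 20 → j ≠ 70 → S' j = S j) ∧
      S' 20 = i ∧ S' 70 = n / 2 ^ i)
    (fun i hi st ⟨S', hst, hS', h20, h70⟩ => by
      subst hst
      have hne : n / 2 ^ i ≠ 0 := fun h0 => by
        have : 2 ^ i ≤ n := Nat.lt_size.1 hi
        have := Nat.div_eq_zero_iff.1 h0
        have : 0 < 2 ^ i := Nat.two_pow_pos i
        omega
      refine ⟨by rw [Operand.read_dir_merge (by norm_num), h70]; exact hne, ?_⟩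
      have hi2 : i + 1 < 2 ^ w := by omega
      obtain ⟨st'', hex, S'', rfl, hS'', h20'', h70''⟩ : ∃ st'', Exec w O
          (block [(.div, .dir 70, .dir 70, .imm 2), (.add, .dir 20, .dir 20, .imm 1)]) ⟨merge S' H, qs⟩ st'' 2 ∧
          ∃ S'', st'' = ⟨merge S'' H, qs⟩ ∧ (∀ j, j ≠ 20 → j ≠ 70 → S'' j = S' j) ∧ S'' 20 = i + 1 ∧
            S'' 70 = n / 2 ^ i / 2 := by
        refine Exec.block_of_fwd _ _ fun R hR => ?_
        have htmp := execOps_cons_fwd hR; clear hR; obtain ⟨v1, hv1, hR⟩ := htmp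
        simp -failIfUnchanged (disch := omega) only [Operand.write, Operand.read, merge_apply_of_lt,
          merge_apply_of_le, Function.update_self, Function.update_of_ne, update_merge_of_lt,
          update_merge_of_le, Nat.add_zero, Nat.zero_add, BinOp.eval_mod, BinOp.eval_eq, BinOp.eval_band,
          BinOp.eval_shr, BinOp.eval_div, BinOp.eval_lt, BinOp.eval_add_of_lt, BinOp.eval_sub_of_le,
          BinOp.eval_mul_of_lt, h20, h70] at hv1 hR
        have htmp := execOps_cons_fwd hR; clear hR; obtain ⟨v2, hv2, hR⟩ := htmp
        simp -failIfUnchanged (disch := omega) only [Operand.write, Operand.read, merge_apply_of_lt,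
          merge_apply_of_le, Function.update_self, Function.update_of_ne, update_merge_of_lt,
          update_merge_of_le, Nat.add_zero, Nat.zero_add, BinOp.eval_mod, BinOp.eval_eq, BinOp.eval_band,
          BinOp.eval_shr, BinOp.eval_div, BinOp.eval_lt, BinOp.eval_add_of_lt, BinOp.eval_sub_of_le,
          BinOp.eval_mul_of_lt, h20, h70] at hv2 hR
        simp only [execOps_nil] at hR; subst hR; subst hv1 hv2
        exact ⟨_, rfl, fun j a b => by simp [Function.update_of_ne, a, b], by simp, by simp⟩
      exact ⟨_, hex.execLE, S'', rfl, fun j a b => (hS'' j a b).trans (hS' j a b), h20'', by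
        rw [h70'', pow_succ, Nat.div_div_eq_div_mul]⟩)
    (fun st ⟨S', hst, _, _, h70⟩ => by
      subst hst; rw [Operand.read_dir_merge (by norm_num), h70]
      exact Nat.div_eq_of_lt (Nat.lt_size_self n))
    ⟨S₁, rfl, hS₁, h20₁, by rw [h70₁, pow_zero, Nat.div_one]⟩
  refine ⟨S', ?_, hS', h20', by
    rw [h70']; exact Nat.div_eq_of_lt (Nat.lt_size_self n)⟩
  have := hex₁.execLE.seqs_cons (ExecLE.seqs_one hex)
  unfold bitlen
  exact this.mono (by omega)

/-! ## Setup -/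

/-- Setup, block 1: `M`, `2M`, `4M`, `BIGC`, `2M ± 1`, `4M + 1`, `L`. [folklore] -/
theorem setup1_spec {w : ℕ} {O : List ℕ → List ℕ} (c : ℕ) {n F : ℕ} {S H : ℕ → ℕ} {qs : List (List ℕ)}
    (h20 : S 20 = Nat.size n)
    (hn : 1 ≤ n) (hF : 100 ≤ F)
    (hcs : Nat.size n * (c + 1) < 2 ^ w) (hcapB : 2 * (32 * cM c n + 9) < 2 ^ w)
    (hcapW : F + wspNT n < 2 ^ w) (hcapN : (n + cL n) * n + (n + cL n) < 2 ^ w)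
    (hcapNB : cNB n * cNB n * cNB n < 2 ^ w) :
    ∃ st₁, Exec w O (block (setupOps1 c)) ⟨merge S H, qs⟩ st₁ 12 ∧ ∃ S₁, st₁ = ⟨merge S₁ H, qs⟩ ∧
      (∀ i, i ≠ 70 → i ≠ 21 → i ≠ 22 → i ≠ 23 → i ≠ 24 → i ≠ 19 → i ≠ 15 → i ≠ 14 → i ≠ 25 → S₁ i = S i) ∧
      S₁ 21 = cM c n ∧ S₁ 22 = 2 * cM c n ∧ S₁ 23 = 4 * cM c n ∧ S₁ 24 = 32 * cM c n + 9 ∧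
      S₁ 19 = 2 * cM c n + 1 ∧ S₁ 15 = 2 * cM c n - 1 ∧ S₁ 14 = 4 * cM c n + 1 ∧ S₁ 25 = cL n := by
  have hM1 : 1 ≤ cM c n := one_le_cM c n
  have hL1 : 1 ≤ cL n := one_le_cL n
  have hLL : cL n ≤ cL n * cL n := Nat.le_mul_self _
  have hnn : n ≤ n * n := Nat.le_mul_self _
  have hsz : Nat.size n ≤ n := size_le_self n
  have hNB1 : 1 ≤ cNB n := by unfold cNB; exact Nat.div_pos (by omega) (by omega)
  have hNB2 : cNB n ≤ cNB n * cNB n := Nat.le_mul_self _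
  have hNB3 : cNB n * cNB n ≤ cNB n * cNB n * cNB n := Nat.le_mul_of_pos_right _ hNB1
  have hwsp : wspNT n = 2 * (n * n) + 9 * (cL n * cL n) + 3 := rfl
  have hpowM : 1 * 2 ^ (Nat.size n * (c + 1)) = cM c n := by rw [Nat.one_mul, Nat.mul_comm]; rfl
  have hpowL : 1 * 2 ^ ((Nat.size n + 5) / 6) = cL n := by rw [Nat.one_mul]; rfl
  refine Exec.block_of_fwd _ _ fun R hR => ?_
  unfold setupOps1 at hR
  have htmp := execOps_cons_fwd hR; clear hR; obtain ⟨v1, hv1, hR⟩ := htmp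
  simp -failIfUnchanged (disch := omega) only [Operand.write, Operand.read, merge_apply_of_lt,
    merge_apply_of_le, Function.update_self, Function.update_of_ne, update_merge_of_lt,
    update_merge_of_le, Nat.add_zero, Nat.zero_add, BinOp.eval_mod, BinOp.eval_eq, BinOp.eval_band,
    BinOp.eval_shr, BinOp.eval_div, BinOp.eval_lt, BinOp.eval_add_of_lt, BinOp.eval_sub_of_le,
    BinOp.eval_mul_of_lt, h20] at hv1 hR
  have htmp := execOps_cons_fwd hR; clear hR; obtain ⟨v2, hv2, hR⟩ := htmp
  simp -failIfUnchanged (disch := omega) only [Operand.write, Operand.read, merge_apply_of_lt,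
    merge_apply_of_le, Function.update_self, Function.update_of_ne, update_merge_of_lt,
    update_merge_of_le, Nat.add_zero, Nat.zero_add, BinOp.eval_mod, BinOp.eval_eq, BinOp.eval_band,
    BinOp.eval_shr, BinOp.eval_div, BinOp.eval_lt, BinOp.eval_add_of_lt, BinOp.eval_sub_of_le,
    BinOp.eval_mul_of_lt, h20] at hv2 hR
  rw [← hv1, BinOp.eval_shl_of_lt (by rw [hpowM]; omega), hpowM] at hv2; subst hv2 hv1
  have htmp := execOps_cons_fwd hR; clear hR; obtain ⟨v3, hv3, hR⟩ := htmp
  simp -failIfUnchanged (disch := omega) only [Operand.write, Operand.read, merge_apply_of_lt,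
    merge_apply_of_le, Function.update_self, Function.update_of_ne, update_merge_of_lt,
    update_merge_of_le, Nat.add_zero, Nat.zero_add, BinOp.eval_mod, BinOp.eval_eq, BinOp.eval_band,
    BinOp.eval_shr, BinOp.eval_div, BinOp.eval_lt, BinOp.eval_add_of_lt, BinOp.eval_sub_of_le,
    BinOp.eval_mul_of_lt, h20] at hv3 hR
  have htmp := execOps_cons_fwd hR; clear hR; obtain ⟨v4, hv4, hR⟩ := htmp
  simp -failIfUnchanged (disch := omega) only [Operand.write, Operand.read, merge_apply_of_lt,
    merge_apply_of_le, Function.update_self, Function.update_of_ne, update_merge_of_lt,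
    update_merge_of_le, Nat.add_zero, Nat.zero_add, BinOp.eval_mod, BinOp.eval_eq, BinOp.eval_band,
    BinOp.eval_shr, BinOp.eval_div, BinOp.eval_lt, BinOp.eval_add_of_lt, BinOp.eval_sub_of_le,
    BinOp.eval_mul_of_lt, h20] at hv4 hR
  have htmp := execOps_cons_fwd hR; clear hR; obtain ⟨v5, hv5, hR⟩ := htmp
  simp -failIfUnchanged (disch := omega) only [Operand.write, Operand.read, merge_apply_of_lt,
    merge_apply_of_le, Function.update_self, Function.update_of_ne, update_merge_of_lt,
    update_merge_of_le, Nat.add_zero, Nat.zero_add, BinOp.eval_mod, BinOp.eval_eq, BinOp.eval_band,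
    BinOp.eval_shr, BinOp.eval_div, BinOp.eval_lt, BinOp.eval_add_of_lt, BinOp.eval_sub_of_le,
    BinOp.eval_mul_of_lt, h20] at hv5 hR
  have htmp := execOps_cons_fwd hR; clear hR; obtain ⟨v6, hv6, hR⟩ := htmp
  simp -failIfUnchanged (disch := omega) only [Operand.write, Operand.read, merge_apply_of_lt,
    merge_apply_of_le, Function.update_self, Function.update_of_ne, update_merge_of_lt,
    update_merge_of_le, Nat.add_zero, Nat.zero_add, BinOp.eval_mod, BinOp.eval_eq, BinOp.eval_band,
    BinOp.eval_shr, BinOp.eval_div, BinOp.eval_lt, BinOp.eval_add_of_lt, BinOp.eval_sub_of_le,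
    BinOp.eval_mul_of_lt, h20] at hv6 hR
  have htmp := execOps_cons_fwd hR; clear hR; obtain ⟨v7, hv7, hR⟩ := htmp
  simp -failIfUnchanged (disch := omega) only [Operand.write, Operand.read, merge_apply_of_lt,
    merge_apply_of_le, Function.update_self, Function.update_of_ne, update_merge_of_lt,
    update_merge_of_le, Nat.add_zero, Nat.zero_add, BinOp.eval_mod, BinOp.eval_eq, BinOp.eval_band,
    BinOp.eval_shr, BinOp.eval_div, BinOp.eval_lt, BinOp.eval_add_of_lt, BinOp.eval_sub_of_le,
    BinOp.eval_mul_of_lt, h20] at hv7 hR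
  have htmp := execOps_cons_fwd hR; clear hR; obtain ⟨v8, hv8, hR⟩ := htmp
  simp -failIfUnchanged (disch := omega) only [Operand.write, Operand.read, merge_apply_of_lt,
    merge_apply_of_le, Function.update_self, Function.update_of_ne, update_merge_of_lt,
    update_merge_of_le, Nat.add_zero, Nat.zero_add, BinOp.eval_mod, BinOp.eval_eq, BinOp.eval_band,
    BinOp.eval_shr, BinOp.eval_div, BinOp.eval_lt, BinOp.eval_add_of_lt, BinOp.eval_sub_of_le,
    BinOp.eval_mul_of_lt, h20] at hv8 hR
  have htmp := execOps_cons_fwd hR; clear hR; obtain ⟨v9, hv9, hR⟩ := htmp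
  simp -failIfUnchanged (disch := omega) only [Operand.write, Operand.read, merge_apply_of_lt,
    merge_apply_of_le, Function.update_self, Function.update_of_ne, update_merge_of_lt,
    update_merge_of_le, Nat.add_zero, Nat.zero_add, BinOp.eval_mod, BinOp.eval_eq, BinOp.eval_band,
    BinOp.eval_shr, BinOp.eval_div, BinOp.eval_lt, BinOp.eval_add_of_lt, BinOp.eval_sub_of_le,
    BinOp.eval_mul_of_lt, h20] at hv9 hR
  have htmp := execOps_cons_fwd hR; clear hR; obtain ⟨v10, hv10, hR⟩ := htmp
  simp -failIfUnchanged (disch := omega) only [Operand.write, Operand.read, merge_apply_of_lt,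
    merge_apply_of_le, Function.update_self, Function.update_of_ne, update_merge_of_lt,
    update_merge_of_le, Nat.add_zero, Nat.zero_add, BinOp.eval_mod, BinOp.eval_eq, BinOp.eval_band,
    BinOp.eval_shr, BinOp.eval_div, BinOp.eval_lt, BinOp.eval_add_of_lt, BinOp.eval_sub_of_le,
    BinOp.eval_mul_of_lt, h20] at hv10 hR
  have htmp := execOps_cons_fwd hR; clear hR; obtain ⟨v11, hv11, hR⟩ := htmp
  simp -failIfUnchanged (disch := omega) only [Operand.write, Operand.read, merge_apply_of_lt,
    merge_apply_of_le, Function.update_self, Function.update_of_ne, update_merge_of_lt,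
    update_merge_of_le, Nat.add_zero, Nat.zero_add, BinOp.eval_mod, BinOp.eval_eq, BinOp.eval_band,
    BinOp.eval_shr, BinOp.eval_div, BinOp.eval_lt, BinOp.eval_add_of_lt, BinOp.eval_sub_of_le,
    BinOp.eval_mul_of_lt, h20] at hv11 hR
  have htmp := execOps_cons_fwd hR; clear hR; obtain ⟨v12, hv12, hR⟩ := htmp
  simp -failIfUnchanged (disch := omega) only [Operand.write, Operand.read, merge_apply_of_lt,
    merge_apply_of_le, Function.update_self, Function.update_of_ne, update_merge_of_lt,
    update_merge_of_le, Nat.add_zero, Nat.zero_add, BinOp.eval_mod, BinOp.eval_eq, BinOp.eval_band,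
    BinOp.eval_shr, BinOp.eval_div, BinOp.eval_lt, BinOp.eval_add_of_lt, BinOp.eval_sub_of_le,
    BinOp.eval_mul_of_lt, h20] at hv12 hR
  rw [← hv11, ← hv10, BinOp.eval_shl_of_lt (by rw [hpowL]; omega), hpowL] at hv12
  simp only [execOps_nil] at hR; subst hR
  subst hv12 hv11 hv10 hv9 hv8 hv7 hv6 hv5 hv4 hv3
  refine ⟨_, rfl, fun i a1 a2 a3 a4 a5 a6 a7 a8 a9 => ?_, ?_, ?_, ?_, ?_, ?_, ?_, ?_, ?_⟩
  · simp only [Function.update_of_ne, ne_eq, not_false_eq_true, a1, a2, a3, a4, a5, a6, a7, a8, a9]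
  all_goals simp only [Function.update_of_ne, Function.update_self, ne_eq, Nat.reduceEqDiff,
    not_false_eq_true]
  all_goals omega

/-- Setup, block 2: `nb`, `3L`, `L²`, `QLEN`, `n²`, `FDB`, `QB`, `AB`, `AB + 1`, `QB + 1`. [folklore] -/
theorem setup2_spec {w : ℕ} {O : List ℕ → List ℕ} (c : ℕ) {n F : ℕ} {S₁ H : ℕ → ℕ} {qs : List (List ℕ)}
    (h2₁ : S₁ 2 = n) (h9₁ : S₁ 9 = F) (h25₁ : S₁ 25 = cL n)
    (hn : 1 ≤ n) (hF : 100 ≤ F)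
    (hcapW : F + wspNT n < 2 ^ w) (hcapN : (n + cL n) * n + (n + cL n) < 2 ^ w) :
    ∃ st₂, Exec w O (block setupOps2) ⟨merge S₁ H, qs⟩ st₂ 13 ∧ ∃ S₂, st₂ = ⟨merge S₂ H, qs⟩ ∧
      (∀ i, i ≠ 70 → i ≠ 26 → i ≠ 27 → i ≠ 29 → i ≠ 28 → i ≠ 35 → i ≠ 30 → i ≠ 31 → i ≠ 32 → i ≠ 36 →
        i ≠ 37 → S₂ i = S₁ i) ∧
      S₂ 26 = cNB n ∧ S₂ 27 = 3 * cL n ∧ S₂ 29 = cL n * cL n ∧ S₂ 28 = 9 * (cL n * cL n) + 1 ∧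
      S₂ 35 = n * n ∧ S₂ 30 = F + n * n ∧ S₂ 31 = F + 2 * (n * n) ∧
      S₂ 32 = F + 2 * (n * n) + (9 * (cL n * cL n) + 1) ∧
      S₂ 36 = F + 2 * (n * n) + (9 * (cL n * cL n) + 1) + 1 ∧ S₂ 37 = F + 2 * (n * n) + 1 := by
  have hM1 : 1 ≤ cM c n := one_le_cM c n
  have hL1 : 1 ≤ cL n := one_le_cL n
  have hLL : cL n ≤ cL n * cL n := Nat.le_mul_self _
  have hnn : n ≤ n * n := Nat.le_mul_self _
  have hsz : Nat.size n ≤ n := size_le_self n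
  have hNB1 : 1 ≤ cNB n := by unfold cNB; exact Nat.div_pos (by omega) (by omega)
  have hNB2 : cNB n ≤ cNB n * cNB n := Nat.le_mul_self _
  have hNB3 : cNB n * cNB n ≤ cNB n * cNB n * cNB n := Nat.le_mul_of_pos_right _ hNB1
  have hwsp : wspNT n = 2 * (n * n) + 9 * (cL n * cL n) + 3 := rfl
  refine Exec.block_of_fwd _ _ fun R hR => ?_
  unfold setupOps2 at hR
  have htmp := execOps_cons_fwd hR; clear hR; obtain ⟨v1, hv1, hR⟩ := htmp
  simp -failIfUnchanged (disch := omega) only [Operand.write, Operand.read, merge_apply_of_lt,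
    merge_apply_of_le, Function.update_self, Function.update_of_ne, update_merge_of_lt,
    update_merge_of_le, Nat.add_zero, Nat.zero_add, BinOp.eval_mod, BinOp.eval_eq, BinOp.eval_band,
    BinOp.eval_shr, BinOp.eval_div, BinOp.eval_lt, BinOp.eval_add_of_lt, BinOp.eval_sub_of_le,
    BinOp.eval_mul_of_lt, h2₁, h9₁, h25₁] at hv1 hR
  have htmp := execOps_cons_fwd hR; clear hR; obtain ⟨v2, hv2, hR⟩ := htmp
  simp -failIfUnchanged (disch := omega) only [Operand.write, Operand.read, merge_apply_of_lt,
    merge_apply_of_le, Function.update_self, Function.update_of_ne, update_merge_of_lt,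
    update_merge_of_le, Nat.add_zero, Nat.zero_add, BinOp.eval_mod, BinOp.eval_eq, BinOp.eval_band,
    BinOp.eval_shr, BinOp.eval_div, BinOp.eval_lt, BinOp.eval_add_of_lt, BinOp.eval_sub_of_le,
    BinOp.eval_mul_of_lt, h2₁, h9₁, h25₁] at hv2 hR
  have htmp := execOps_cons_fwd hR; clear hR; obtain ⟨v3, hv3, hR⟩ := htmp
  simp -failIfUnchanged (disch := omega) only [Operand.write, Operand.read, merge_apply_of_lt,
    merge_apply_of_le, Function.update_self, Function.update_of_ne, update_merge_of_lt,
    update_merge_of_le, Nat.add_zero, Nat.zero_add, BinOp.eval_mod, BinOp.eval_eq, BinOp.eval_band,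
    BinOp.eval_shr, BinOp.eval_div, BinOp.eval_lt, BinOp.eval_add_of_lt, BinOp.eval_sub_of_le,
    BinOp.eval_mul_of_lt, h2₁, h9₁, h25₁] at hv3 hR
  have htmp := execOps_cons_fwd hR; clear hR; obtain ⟨v4, hv4, hR⟩ := htmp
  simp -failIfUnchanged (disch := omega) only [Operand.write, Operand.read, merge_apply_of_lt,
    merge_apply_of_le, Function.update_self, Function.update_of_ne, update_merge_of_lt,
    update_merge_of_le, Nat.add_zero, Nat.zero_add, BinOp.eval_mod, BinOp.eval_eq, BinOp.eval_band,
    BinOp.eval_shr, BinOp.eval_div, BinOp.eval_lt, BinOp.eval_add_of_lt, BinOp.eval_sub_of_le,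
    BinOp.eval_mul_of_lt, h2₁, h9₁, h25₁] at hv4 hR
  have htmp := execOps_cons_fwd hR; clear hR; obtain ⟨v5, hv5, hR⟩ := htmp
  simp -failIfUnchanged (disch := omega) only [Operand.write, Operand.read, merge_apply_of_lt,
    merge_apply_of_le, Function.update_self, Function.update_of_ne, update_merge_of_lt,
    update_merge_of_le, Nat.add_zero, Nat.zero_add, BinOp.eval_mod, BinOp.eval_eq, BinOp.eval_band,
    BinOp.eval_shr, BinOp.eval_div, BinOp.eval_lt, BinOp.eval_add_of_lt, BinOp.eval_sub_of_le,
    BinOp.eval_mul_of_lt, h2₁, h9₁, h25₁] at hv5 hR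
  have htmp := execOps_cons_fwd hR; clear hR; obtain ⟨v6, hv6, hR⟩ := htmp
  simp -failIfUnchanged (disch := omega) only [Operand.write, Operand.read, merge_apply_of_lt,
    merge_apply_of_le, Function.update_self, Function.update_of_ne, update_merge_of_lt,
    update_merge_of_le, Nat.add_zero, Nat.zero_add, BinOp.eval_mod, BinOp.eval_eq, BinOp.eval_band,
    BinOp.eval_shr, BinOp.eval_div, BinOp.eval_lt, BinOp.eval_add_of_lt, BinOp.eval_sub_of_le,
    BinOp.eval_mul_of_lt, h2₁, h9₁, h25₁] at hv6 hR
  have htmp := execOps_cons_fwd hR; clear hR; obtain ⟨v7, hv7, hR⟩ := htmp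
  simp -failIfUnchanged (disch := omega) only [Operand.write, Operand.read, merge_apply_of_lt,
    merge_apply_of_le, Function.update_self, Function.update_of_ne, update_merge_of_lt,
    update_merge_of_le, Nat.add_zero, Nat.zero_add, BinOp.eval_mod, BinOp.eval_eq, BinOp.eval_band,
    BinOp.eval_shr, BinOp.eval_div, BinOp.eval_lt, BinOp.eval_add_of_lt, BinOp.eval_sub_of_le,
    BinOp.eval_mul_of_lt, h2₁, h9₁, h25₁] at hv7 hR
  have htmp := execOps_cons_fwd hR; clear hR; obtain ⟨v8, hv8, hR⟩ := htmp
  simp -failIfUnchanged (disch := omega) only [Operand.write, Operand.read, merge_apply_of_lt,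
    merge_apply_of_le, Function.update_self, Function.update_of_ne, update_merge_of_lt,
    update_merge_of_le, Nat.add_zero, Nat.zero_add, BinOp.eval_mod, BinOp.eval_eq, BinOp.eval_band,
    BinOp.eval_shr, BinOp.eval_div, BinOp.eval_lt, BinOp.eval_add_of_lt, BinOp.eval_sub_of_le,
    BinOp.eval_mul_of_lt, h2₁, h9₁, h25₁] at hv8 hR
  have htmp := execOps_cons_fwd hR; clear hR; obtain ⟨v9, hv9, hR⟩ := htmp
  simp -failIfUnchanged (disch := omega) only [Operand.write, Operand.read, merge_apply_of_lt,
    merge_apply_of_le, Function.update_self, Function.update_of_ne, update_merge_of_lt,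
    update_merge_of_le, Nat.add_zero, Nat.zero_add, BinOp.eval_mod, BinOp.eval_eq, BinOp.eval_band,
    BinOp.eval_shr, BinOp.eval_div, BinOp.eval_lt, BinOp.eval_add_of_lt, BinOp.eval_sub_of_le,
    BinOp.eval_mul_of_lt, h2₁, h9₁, h25₁] at hv9 hR
  have htmp := execOps_cons_fwd hR; clear hR; obtain ⟨v10, hv10, hR⟩ := htmp
  simp -failIfUnchanged (disch := omega) only [Operand.write, Operand.read, merge_apply_of_lt,
    merge_apply_of_le, Function.update_self, Function.update_of_ne, update_merge_of_lt,
    update_merge_of_le, Nat.add_zero, Nat.zero_add, BinOp.eval_mod, BinOp.eval_eq, BinOp.eval_band,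
    BinOp.eval_shr, BinOp.eval_div, BinOp.eval_lt, BinOp.eval_add_of_lt, BinOp.eval_sub_of_le,
    BinOp.eval_mul_of_lt, h2₁, h9₁, h25₁] at hv10 hR
  have htmp := execOps_cons_fwd hR; clear hR; obtain ⟨v11, hv11, hR⟩ := htmp
  simp -failIfUnchanged (disch := omega) only [Operand.write, Operand.read, merge_apply_of_lt,
    merge_apply_of_le, Function.update_self, Function.update_of_ne, update_merge_of_lt,
    update_merge_of_le, Nat.add_zero, Nat.zero_add, BinOp.eval_mod, BinOp.eval_eq, BinOp.eval_band,
    BinOp.eval_shr, BinOp.eval_div, BinOp.eval_lt, BinOp.eval_add_of_lt, BinOp.eval_sub_of_le,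
    BinOp.eval_mul_of_lt, h2₁, h9₁, h25₁] at hv11 hR
  have htmp := execOps_cons_fwd hR; clear hR; obtain ⟨v12, hv12, hR⟩ := htmp
  simp -failIfUnchanged (disch := omega) only [Operand.write, Operand.read, merge_apply_of_lt,
    merge_apply_of_le, Function.update_self, Function.update_of_ne, update_merge_of_lt,
    update_merge_of_le, Nat.add_zero, Nat.zero_add, BinOp.eval_mod, BinOp.eval_eq, BinOp.eval_band,
    BinOp.eval_shr, BinOp.eval_div, BinOp.eval_lt, BinOp.eval_add_of_lt, BinOp.eval_sub_of_le,
    BinOp.eval_mul_of_lt, h2₁, h9₁, h25₁] at hv12 hR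
  have htmp := execOps_cons_fwd hR; clear hR; obtain ⟨v13, hv13, hR⟩ := htmp
  simp -failIfUnchanged (disch := omega) only [Operand.write, Operand.read, merge_apply_of_lt,
    merge_apply_of_le, Function.update_self, Function.update_of_ne, update_merge_of_lt,
    update_merge_of_le, Nat.add_zero, Nat.zero_add, BinOp.eval_mod, BinOp.eval_eq, BinOp.eval_band,
    BinOp.eval_shr, BinOp.eval_div, BinOp.eval_lt, BinOp.eval_add_of_lt, BinOp.eval_sub_of_le,
    BinOp.eval_mul_of_lt, h2₁, h9₁, h25₁] at hv13 hR
  simp only [execOps_nil] at hR; subst hR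
  subst hv13 hv12 hv11 hv10 hv9 hv8 hv7 hv6 hv5 hv4 hv3 hv2 hv1
  refine ⟨_, rfl, fun i a1 a2 a3 a4 a5 a6 a7 a8 a9 a10 a11 => ?_, ?_, ?_, ?_, ?_, ?_, ?_, ?_, ?_, ?_, ?_⟩
  · simp only [Function.update_of_ne, ne_eq, not_false_eq_true, a1, a2, a3, a4, a5, a6, a7, a8, a9, a10, a11]
  all_goals simp only [Function.update_of_ne, Function.update_self, ne_eq, Nat.reduceEqDiff,
    not_false_eq_true]
  · rfl
  all_goals omega

/-- Setup, block 3: `nb²`, `nb³`, `TB`, `XB`, `YB`, the query header, the fill registers, `pw`. [folklore] -/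
theorem setup3_spec {w : ℕ} {O : List ℕ → List ℕ} (c : ℕ) {n F : ℕ} {S₂ H : ℕ → ℕ} {qs : List (List ℕ)}
    (h23₂ : S₂ 23 = 4 * cM c n) (h25₂ : S₂ 25 = cL n) (h26₂ : S₂ 26 = cNB n) (h27₂ : S₂ 27 = 3 * cL n)
    (h29₂ : S₂ 29 = cL n * cL n) (h31₂ : S₂ 31 = F + 2 * (n * n)) (h37₂ : S₂ 37 = F + 2 * (n * n) + 1)
    (hn : 1 ≤ n) (hF : 100 ≤ F) (hcapB : 2 * (32 * cM c n + 9) < 2 ^ w)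
    (hcapW : F + wspNT n < 2 ^ w) (hcapNB : cNB n * cNB n * cNB n < 2 ^ w) :
    ∃ st₃, Exec w O (block setupOps3) ⟨merge S₂ H, qs⟩ st₃ 13 ∧ ∃ S₃ H₃, st₃ = ⟨merge S₃ H₃, qs⟩ ∧
      (∀ i, i ≠ 70 → i ≠ 34 → i ≠ 33 → i ≠ 38 → i ≠ 39 → i ≠ 18 → i ≠ 71 → i ≠ 72 → i ≠ 40 → S₃ i = S₂ i) ∧
      S₃ 34 = cNB n * cNB n ∧ S₃ 33 = cNB n * cNB n * cNB n ∧
      S₃ 38 = F + 2 * (n * n) + 1 + 6 * (cL n * cL n) ∧ S₃ 39 = F + 2 * (n * n) + 1 + cL n ∧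
      S₃ 18 = F + 2 * (n * n) + 1 + 3 * (cL n * cL n) + cL n + cL n ∧
      S₃ 71 = 9 * (cL n * cL n) ∧ S₃ 72 = F + 2 * (n * n) + 1 ∧ S₃ 40 = 4 * cM c n ∧
      H₃ = Function.update H (F + 2 * (n * n)) (3 * cL n) := by
  have hM1 : 1 ≤ cM c n := one_le_cM c n
  have hL1 : 1 ≤ cL n := one_le_cL n
  have hLL : cL n ≤ cL n * cL n := Nat.le_mul_self _
  have hnn : n ≤ n * n := Nat.le_mul_self _
  have hsz : Nat.size n ≤ n := size_le_self n
  have hNB1 : 1 ≤ cNB n := by unfold cNB; exact Nat.div_pos (by omega) (by omega)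
  have hNB2 : cNB n ≤ cNB n * cNB n := Nat.le_mul_self _
  have hNB3 : cNB n * cNB n ≤ cNB n * cNB n * cNB n := Nat.le_mul_of_pos_right _ hNB1
  have hwsp : wspNT n = 2 * (n * n) + 9 * (cL n * cL n) + 3 := rfl
  refine Exec.block_of_fwd _ _ fun R hR => ?_
  unfold setupOps3 at hR
  have htmp := execOps_cons_fwd hR; clear hR; obtain ⟨v1, hv1, hR⟩ := htmp
  simp -failIfUnchanged (disch := omega) only [Operand.write, Operand.read, merge_apply_of_lt,
    merge_apply_of_le, Function.update_self, Function.update_of_ne, update_merge_of_lt,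
    update_merge_of_le, Nat.add_zero, Nat.zero_add, BinOp.eval_mod, BinOp.eval_eq, BinOp.eval_band,
    BinOp.eval_shr, BinOp.eval_div, BinOp.eval_lt, BinOp.eval_add_of_lt, BinOp.eval_sub_of_le,
    BinOp.eval_mul_of_lt, h23₂, h25₂, h26₂, h27₂, h29₂, h31₂, h37₂] at hv1 hR
  subst hv1
  have htmp := execOps_cons_fwd hR; clear hR; obtain ⟨v2, hv2, hR⟩ := htmp
  simp -failIfUnchanged (disch := omega) only [Operand.write, Operand.read, merge_apply_of_lt,
    merge_apply_of_le, Function.update_self, Function.update_of_ne, update_merge_of_lt,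
    update_merge_of_le, Nat.add_zero, Nat.zero_add, BinOp.eval_mod, BinOp.eval_eq, BinOp.eval_band,
    BinOp.eval_shr, BinOp.eval_div, BinOp.eval_lt, BinOp.eval_add_of_lt, BinOp.eval_sub_of_le,
    BinOp.eval_mul_of_lt, h23₂, h25₂, h26₂, h27₂, h29₂, h31₂, h37₂] at hv2 hR
  have htmp := execOps_cons_fwd hR; clear hR; obtain ⟨v3, hv3, hR⟩ := htmp
  simp -failIfUnchanged (disch := omega) only [Operand.write, Operand.read, merge_apply_of_lt,
    merge_apply_of_le, Function.update_self, Function.update_of_ne, update_merge_of_lt,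
    update_merge_of_le, Nat.add_zero, Nat.zero_add, BinOp.eval_mod, BinOp.eval_eq, BinOp.eval_band,
    BinOp.eval_shr, BinOp.eval_div, BinOp.eval_lt, BinOp.eval_add_of_lt, BinOp.eval_sub_of_le,
    BinOp.eval_mul_of_lt, h23₂, h25₂, h26₂, h27₂, h29₂, h31₂, h37₂] at hv3 hR
  have htmp := execOps_cons_fwd hR; clear hR; obtain ⟨v4, hv4, hR⟩ := htmp
  simp -failIfUnchanged (disch := omega) only [Operand.write, Operand.read, merge_apply_of_lt,
    merge_apply_of_le, Function.update_self, Function.update_of_ne, update_merge_of_lt,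
    update_merge_of_le, Nat.add_zero, Nat.zero_add, BinOp.eval_mod, BinOp.eval_eq, BinOp.eval_band,
    BinOp.eval_shr, BinOp.eval_div, BinOp.eval_lt, BinOp.eval_add_of_lt, BinOp.eval_sub_of_le,
    BinOp.eval_mul_of_lt, h23₂, h25₂, h26₂, h27₂, h29₂, h31₂, h37₂] at hv4 hR
  have htmp := execOps_cons_fwd hR; clear hR; obtain ⟨v5, hv5, hR⟩ := htmp
  simp -failIfUnchanged (disch := omega) only [Operand.write, Operand.read, merge_apply_of_lt,
    merge_apply_of_le, Function.update_self, Function.update_of_ne, update_merge_of_lt,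
    update_merge_of_le, Nat.add_zero, Nat.zero_add, BinOp.eval_mod, BinOp.eval_eq, BinOp.eval_band,
    BinOp.eval_shr, BinOp.eval_div, BinOp.eval_lt, BinOp.eval_add_of_lt, BinOp.eval_sub_of_le,
    BinOp.eval_mul_of_lt, h23₂, h25₂, h26₂, h27₂, h29₂, h31₂, h37₂] at hv5 hR
  have htmp := execOps_cons_fwd hR; clear hR; obtain ⟨v6, hv6, hR⟩ := htmp
  simp -failIfUnchanged (disch := omega) only [Operand.write, Operand.read, merge_apply_of_lt,
    merge_apply_of_le, Function.update_self, Function.update_of_ne, update_merge_of_lt,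
    update_merge_of_le, Nat.add_zero, Nat.zero_add, BinOp.eval_mod, BinOp.eval_eq, BinOp.eval_band,
    BinOp.eval_shr, BinOp.eval_div, BinOp.eval_lt, BinOp.eval_add_of_lt, BinOp.eval_sub_of_le,
    BinOp.eval_mul_of_lt, h23₂, h25₂, h26₂, h27₂, h29₂, h31₂, h37₂] at hv6 hR
  have htmp := execOps_cons_fwd hR; clear hR; obtain ⟨v7, hv7, hR⟩ := htmp
  simp -failIfUnchanged (disch := omega) only [Operand.write, Operand.read, merge_apply_of_lt,
    merge_apply_of_le, Function.update_self, Function.update_of_ne, update_merge_of_lt,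
    update_merge_of_le, Nat.add_zero, Nat.zero_add, BinOp.eval_mod, BinOp.eval_eq, BinOp.eval_band,
    BinOp.eval_shr, BinOp.eval_div, BinOp.eval_lt, BinOp.eval_add_of_lt, BinOp.eval_sub_of_le,
    BinOp.eval_mul_of_lt, h23₂, h25₂, h26₂, h27₂, h29₂, h31₂, h37₂] at hv7 hR
  have htmp := execOps_cons_fwd hR; clear hR; obtain ⟨v8, hv8, hR⟩ := htmp
  simp -failIfUnchanged (disch := omega) only [Operand.write, Operand.read, merge_apply_of_lt,
    merge_apply_of_le, Function.update_self, Function.update_of_ne, update_merge_of_lt,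
    update_merge_of_le, Nat.add_zero, Nat.zero_add, BinOp.eval_mod, BinOp.eval_eq, BinOp.eval_band,
    BinOp.eval_shr, BinOp.eval_div, BinOp.eval_lt, BinOp.eval_add_of_lt, BinOp.eval_sub_of_le,
    BinOp.eval_mul_of_lt, h23₂, h25₂, h26₂, h27₂, h29₂, h31₂, h37₂] at hv8 hR
  have htmp := execOps_cons_fwd hR; clear hR; obtain ⟨v9, hv9, hR⟩ := htmp
  simp -failIfUnchanged (disch := omega) only [Operand.write, Operand.read, merge_apply_of_lt,
    merge_apply_of_le, Function.update_self, Function.update_of_ne, update_merge_of_lt,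
    update_merge_of_le, Nat.add_zero, Nat.zero_add, BinOp.eval_mod, BinOp.eval_eq, BinOp.eval_band,
    BinOp.eval_shr, BinOp.eval_div, BinOp.eval_lt, BinOp.eval_add_of_lt, BinOp.eval_sub_of_le,
    BinOp.eval_mul_of_lt, h23₂, h25₂, h26₂, h27₂, h29₂, h31₂, h37₂] at hv9 hR
  have htmp := execOps_cons_fwd hR; clear hR; obtain ⟨v10, hv10, hR⟩ := htmp
  simp -failIfUnchanged (disch := omega) only [Operand.write, Operand.read, merge_apply_of_lt,
    merge_apply_of_le, Function.update_self, Function.update_of_ne, update_merge_of_lt,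
    update_merge_of_le, Nat.add_zero, Nat.zero_add, BinOp.eval_mod, BinOp.eval_eq, BinOp.eval_band,
    BinOp.eval_shr, BinOp.eval_div, BinOp.eval_lt, BinOp.eval_add_of_lt, BinOp.eval_sub_of_le,
    BinOp.eval_mul_of_lt, h23₂, h25₂, h26₂, h27₂, h29₂, h31₂, h37₂] at hv10 hR
  have htmp := execOps_cons_fwd hR; clear hR; obtain ⟨v11, hv11, hR⟩ := htmp
  simp -failIfUnchanged (disch := omega) only [Operand.write, Operand.read, merge_apply_of_lt,
    merge_apply_of_le, Function.update_self, Function.update_of_ne, update_merge_of_lt,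
    update_merge_of_le, Nat.add_zero, Nat.zero_add, BinOp.eval_mod, BinOp.eval_eq, BinOp.eval_band,
    BinOp.eval_shr, BinOp.eval_div, BinOp.eval_lt, BinOp.eval_add_of_lt, BinOp.eval_sub_of_le,
    BinOp.eval_mul_of_lt, h23₂, h25₂, h26₂, h27₂, h29₂, h31₂, h37₂] at hv11 hR
  have htmp := execOps_cons_fwd hR; clear hR; obtain ⟨v12, hv12, hR⟩ := htmp
  simp -failIfUnchanged (disch := omega) only [Operand.write, Operand.read, merge_apply_of_lt,
    merge_apply_of_le, Function.update_self, Function.update_of_ne, update_merge_of_lt,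
    update_merge_of_le, Nat.add_zero, Nat.zero_add, BinOp.eval_mod, BinOp.eval_eq, BinOp.eval_band,
    BinOp.eval_shr, BinOp.eval_div, BinOp.eval_lt, BinOp.eval_add_of_lt, BinOp.eval_sub_of_le,
    BinOp.eval_mul_of_lt, h23₂, h25₂, h26₂, h27₂, h29₂, h31₂, h37₂] at hv12 hR
  have htmp := execOps_cons_fwd hR; clear hR; obtain ⟨v13, hv13, hR⟩ := htmp
  simp -failIfUnchanged (disch := omega) only [Operand.write, Operand.read, merge_apply_of_lt,
    merge_apply_of_le, Function.update_self, Function.update_of_ne, update_merge_of_lt,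
    update_merge_of_le, Nat.add_zero, Nat.zero_add, BinOp.eval_mod, BinOp.eval_eq, BinOp.eval_band,
    BinOp.eval_shr, BinOp.eval_div, BinOp.eval_lt, BinOp.eval_add_of_lt, BinOp.eval_sub_of_le,
    BinOp.eval_mul_of_lt, h23₂, h25₂, h26₂, h27₂, h29₂, h31₂, h37₂] at hv13 hR
  simp only [execOps_nil] at hR; subst hR
  subst hv13 hv12 hv11 hv10 hv9 hv8 hv7 hv6 hv5 hv4 hv3 hv2
  refine ⟨_, _, rfl, fun i a1 a2 a3 a4 a5 a6 a7 a8 a9 => ?_, ?_, ?_, ?_, ?_, ?_, ?_, ?_, ?_, ?_⟩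
  · simp only [Function.update_of_ne, ne_eq, not_false_eq_true, a1, a2, a3, a4, a5, a6, a7, a8, a9]
  all_goals simp only [Function.update_of_ne, Function.update_self, ne_eq, Nat.reduceEqDiff,
    not_false_eq_true]
  all_goals first | rfl | omega

/-- **Semantics of the setup blocks**: from `r2 = n`, `r9 = F`, `r16 = pX`, `r17 = pX + n² + 1`,
`r20 = size n`, the three blocks establish the constant registers `Regs c n F pX`, the registers of
the fill loop (`r71 = 9L²`, `r72 = QB + 1`), the first bit `r40 = 4M`, and the query header
`mem[QB] := 3L`, in `38` steps, touching no register below `14`. [folklore] -/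
theorem setup_spec {w : ℕ} {O : List ℕ → List ℕ} (c : ℕ) {n F pX : ℕ} {S H : ℕ → ℕ} {qs : List (List ℕ)}
    (h2 : S 2 = n) (h9 : S 9 = F) (h16 : S 16 = pX) (h17 : S 17 = pX + n * n + 1)
    (h20 : S 20 = Nat.size n)
    (hn : 1 ≤ n) (hF : 100 ≤ F)
    (hcs : Nat.size n * (c + 1) < 2 ^ w) (hcapB : 2 * (32 * cM c n + 9) < 2 ^ w)
    (hcapW : F + wspNT n < 2 ^ w) (hcapN : (n + cL n) * n + (n + cL n) < 2 ^ w)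
    (hcapNB : cNB n * cNB n * cNB n < 2 ^ w) :
    ∃ S' H', Exec w O (setup c) ⟨merge S H, qs⟩ ⟨merge S' H', qs⟩ 38 ∧
      (∀ i, i < 14 → S' i = S i) ∧ Regs c n F pX S' ∧ S' 40 = 4 * cM c n ∧
      S' 71 = 9 * (cL n * cL n) ∧ S' 72 = F + 2 * (n * n) + 1 ∧
      H' = Function.update H (F + 2 * (n * n)) (3 * cL n) := by
  unfold setup
  obtain ⟨st₁, hex₁, S₁, rfl, hS₁, h21₁, h22₁, h23₁, h24₁, h19₁, h15₁, h14₁, h25₁⟩ :=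
    setup1_spec (O := O) (H := H) (qs := qs) c h20 hn hF hcs hcapB hcapW hcapN hcapNB
  have e1 : ∀ i, i < 14 ∨ i = 16 ∨ i = 17 ∨ i = 20 → S₁ i = S i := fun i hi =>
    hS₁ i (by omega) (by omega) (by omega) (by omega) (by omega) (by omega) (by omega) (by omega) (by omega)
  obtain ⟨st₂, hex₂, S₂, rfl, hS₂, h26₂, h27₂, h29₂, h28₂, h35₂, h30₂, h31₂, h32₂, h36₂, h37₂⟩ :=
    setup2_spec (O := O) (H := H) (qs := qs) c ((e1 2 (by omega)).trans h2) ((e1 9 (by omega)).trans h9)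
      h25₁ hn hF hcapW hcapN
  have e2 : ∀ i, i < 26 → S₂ i = S₁ i := fun i hi =>
    hS₂ i (by omega) (by omega) (by omega) (by omega) (by omega) (by omega) (by omega) (by omega) (by omega)
      (by omega) (by omega)
  obtain ⟨st₃, hex₃, S₃, H₃, rfl, hS₃, h34₃, h33₃, h38₃, h39₃, h18₃, h71₃, h72₃, h40₃, hH₃⟩ :=
    setup3_spec (O := O) (H := H) (qs := qs) c ((e2 23 (by omega)).trans h23₁) ((e2 25 (by omega)).trans h25₁)
      h26₂ h27₂ h29₂ h31₂ h37₂ hn hF hcapB hcapW hcapNB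
  have e3 : ∀ i, i < 33 ∧ i ≠ 18 ∨ 34 < i ∧ i < 38 → S₃ i = S₂ i := fun i hi =>
    hS₃ i (by omega) (by omega) (by omega) (by omega) (by omega) (by omega) (by omega) (by omega) (by omega)
  refine ⟨S₃, H₃, hex₁.seqs_cons (hex₂.seqs_cons (Exec.seqs_one hex₃)), fun i hi => ?_, ?_, h40₃, h71₃,
    h72₃, hH₃⟩
  · rw [e3 i (by omega), e2 i (by omega), e1 i (by omega)]
  exact {
    r2 := by rw [e3 2 (by omega), e2 2 (by omega), e1 2 (by omega), h2]
    r9 := by rw [e3 9 (by omega), e2 9 (by omega), e1 9 (by omega), h9]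
    r14 := by rw [e3 14 (by omega), e2 14 (by omega), h14₁]
    r15 := by rw [e3 15 (by omega), e2 15 (by omega), h15₁]
    r16 := by rw [e3 16 (by omega), e2 16 (by omega), e1 16 (by omega), h16]
    r17 := by rw [e3 17 (by omega), e2 17 (by omega), e1 17 (by omega), h17]
    r18 := h18₃
    r19 := by rw [e3 19 (by omega), e2 19 (by omega), h19₁]
    r20 := by rw [e3 20 (by omega), e2 20 (by omega), e1 20 (by omega), h20]
    r21 := by rw [e3 21 (by omega), e2 21 (by omega), h21₁]
    r22 := by rw [e3 22 (by omega), e2 22 (by omega), h22₁]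
    r23 := by rw [e3 23 (by omega), e2 23 (by omega), h23₁]
    r24 := by rw [e3 24 (by omega), e2 24 (by omega), h24₁]
    r25 := by rw [e3 25 (by omega), e2 25 (by omega), h25₁]
    r26 := by rw [e3 26 (by omega), h26₂]
    r27 := by rw [e3 27 (by omega), h27₂]
    r28 := by rw [e3 28 (by omega), h28₂]
    r29 := by rw [e3 29 (by omega), h29₂]
    r30 := by rw [e3 30 (by omega), h30₂]
    r31 := by rw [e3 31 (by omega), h31₂]
    r32 := by rw [e3 32 (by omega), h32₂]
    r33 := h33₃
    r34 := h34₃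
    r35 := by rw [e3 35 (by omega), h35₂]
    r36 := by rw [e3 36 (by omega), h36₂]
    r37 := by rw [e3 37 (by omega), h37₂]
    r38 := h38₃
    r39 := h39₃ }

/-! ## The fill loop -/

/-- **Semantics of `fillLoop`**: with count `m` in `r71`, pointer `p` in `r72` and the value `BIGC`
in `r24`, the loop writes `BIGC` into the cells `[p, p + m)` in `5 m + 1` steps. [folklore] -/
theorem fill_spec {w : ℕ} {O : List ℕ → List ℕ} {m p BIGC : ℕ} {S H : ℕ → ℕ} {qs : List (List ℕ)}
    (h24 : S 24 = BIGC) (h71 : S 71 = m) (h72 : S 72 = p) (hp : 100 ≤ p) (hB : BIGC < 2 ^ w)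
    (hcap : p + m < 2 ^ w) :
    ∃ S' H', ExecLE w O fillLoop ⟨merge S H, qs⟩ ⟨merge S' H', qs⟩ (m * 5 + 1) ∧
      (∀ i, i ≠ 71 → i ≠ 72 → S' i = S i) ∧
      (∀ a, p ≤ a → a < p + m → H' a = BIGC) ∧ (∀ a, a < p ∨ p + m ≤ a → H' a = H a) := by
  obtain ⟨st', hex, S', H', rfl, hS', -, -, hw, hnw⟩ := ExecLE.whilenz_invariant (w := w) (O := O)
    (x := .dir 71) (s := block [(.add, .ind 72, .dir 24, .imm 0), (.add, .dir 72, .dir 72, .imm 1),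
      (.sub, .dir 71, .dir 71, .imm 1)]) m 3
    (fun i st => ∃ S' H', st = ⟨merge S' H', qs⟩ ∧ (∀ j, j ≠ 71 → j ≠ 72 → S' j = S j) ∧
      S' 71 = m - i ∧ S' 72 = p + i ∧
      (∀ a, p ≤ a → a < p + i → H' a = BIGC) ∧ (∀ a, a < p ∨ p + i ≤ a → H' a = H a))
    (fun i hi st ⟨S', H', hst, hS', h71', h72', hw, hnw⟩ => by
      subst hst
      refine ⟨by rw [Operand.read_dir_merge (by norm_num), h71']; omega, ?_⟩
      have h24' : S' 24 = BIGC := (hS' 24 (by omega) (by omega)).trans h24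
      obtain ⟨st'', hex, S'', H'', rfl, hS'', h71'', h72'', hH''⟩ : ∃ st'', Exec w O
          (block [(.add, .ind 72, .dir 24, .imm 0), (.add, .dir 72, .dir 72, .imm 1),
            (.sub, .dir 71, .dir 71, .imm 1)]) ⟨merge S' H', qs⟩ st'' 3 ∧
          ∃ S'' H'', st'' = ⟨merge S'' H'', qs⟩ ∧ (∀ j, j ≠ 71 → j ≠ 72 → S'' j = S' j) ∧
            S'' 71 = m - i - 1 ∧ S'' 72 = p + i + 1 ∧ H'' = Function.update H' (p + i) BIGC := by
        refine Exec.block_of_fwd _ _ fun R hR => ?_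
        have htmp := execOps_cons_fwd hR; clear hR; obtain ⟨v1, hv1, hR⟩ := htmp
        simp -failIfUnchanged (disch := omega) only [Operand.write, Operand.read, merge_apply_of_lt,
          merge_apply_of_le, Function.update_self, Function.update_of_ne, update_merge_of_lt,
          update_merge_of_le, Nat.add_zero, Nat.zero_add, BinOp.eval_mod, BinOp.eval_eq, BinOp.eval_band,
          BinOp.eval_shr, BinOp.eval_div, BinOp.eval_lt, BinOp.eval_add_of_lt, BinOp.eval_sub_of_le,
          BinOp.eval_mul_of_lt, h24', h71', h72'] at hv1 hR
        have htmp := execOps_cons_fwd hR; clear hR; obtain ⟨v2, hv2, hR⟩ := htmp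
        simp -failIfUnchanged (disch := omega) only [Operand.write, Operand.read, merge_apply_of_lt,
          merge_apply_of_le, Function.update_self, Function.update_of_ne, update_merge_of_lt,
          update_merge_of_le, Nat.add_zero, Nat.zero_add, BinOp.eval_mod, BinOp.eval_eq, BinOp.eval_band,
          BinOp.eval_shr, BinOp.eval_div, BinOp.eval_lt, BinOp.eval_add_of_lt, BinOp.eval_sub_of_le,
          BinOp.eval_mul_of_lt, h24', h71', h72'] at hv2 hR
        have htmp := execOps_cons_fwd hR; clear hR; obtain ⟨v3, hv3, hR⟩ := htmp
        simp -failIfUnchanged (disch := omega) only [Operand.write, Operand.read, merge_apply_of_lt,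
          merge_apply_of_le, Function.update_self, Function.update_of_ne, update_merge_of_lt,
          update_merge_of_le, Nat.add_zero, Nat.zero_add, BinOp.eval_mod, BinOp.eval_eq, BinOp.eval_band,
          BinOp.eval_shr, BinOp.eval_div, BinOp.eval_lt, BinOp.eval_add_of_lt, BinOp.eval_sub_of_le,
          BinOp.eval_mul_of_lt, h24', h71', h72'] at hv3 hR
        simp only [execOps_nil] at hR; subst hR; subst hv1 hv2 hv3
        exact ⟨_, _, rfl, fun j a b => by simp [Function.update_of_ne, a, b], by simp, by simp, rfl⟩
      refine ⟨_, hex.execLE, S'', H'', rfl, fun j a b => (hS'' j a b).trans (hS' j a b), by rw [h71'']; omega,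
        by rw [h72'']; omega, fun a h1 h2 => ?_, fun a ha => ?_⟩
      · rw [hH'']
        rcases Nat.lt_or_ge a (p + i) with hlt | hge
        · rw [Function.update_of_ne (by omega)]; exact hw a h1 hlt
        · rw [show a = p + i by omega, Function.update_self]
      · rw [hH'', Function.update_of_ne (by omega)]; exact hnw a (by omega))
    (fun st ⟨S', H', hst, _, h71', _⟩ => by
      subst hst; rw [Operand.read_dir_merge (by norm_num), h71']; omega)
    ⟨S, H, rfl, fun j _ _ => rfl, by rw [h71]; rfl, by rw [h72]; rfl, fun a h1 h2 => by omega,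
      fun a _ => rfl⟩
  exact ⟨S', H', hex, hS', hw, hnw⟩

end Literature.Computability.FineGrained.NegTriSweep

namespace Literature.Computability.FineGrained.NegTriSweep

open Cryptography Cryptography.WordRAM Cryptography.WordRAM.SProg APSPPower NegTriStep

set_option linter.unusedSimpArgs false

/-! ## The end-of-round update of the lower bounds -/

/-- One iteration of the update loop: `lo[p] += pw [fd[q] ≠ pw]`. [folklore] -/
theorem loUpd_iter {w : ℕ} {O : List ℕ → List ℕ} {pw p q r B : ℕ} {S H : ℕ → ℕ} {qs : List (List ℕ)}
    (h40 : S 40 = pw) (h71 : S 71 = r + 1) (h72 : S 72 = p) (h73 : S 73 = q)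
    (hp : 100 ≤ p) (hq : 100 ≤ q) (hpw : pw < 2 ^ w) (hlo : H p + pw ≤ B) (hB : B < 2 ^ w)
    (hfd : H q < 2 ^ w) (hcap : q + r + 1 < 2 ^ w) (hcap' : p + 1 < 2 ^ w) :
    ∃ S' H', Exec w O (block loUpdBody) ⟨merge S H, qs⟩ ⟨merge S' H', qs⟩ 7 ∧
      (∀ i, i ≠ 71 → i ≠ 72 → i ≠ 73 → i ≠ 74 → S' i = S i) ∧ S' 71 = r ∧ S' 72 = p + 1 ∧
      S' 73 = q + 1 ∧ H' = Function.update H p (H p + if H q = pw then 0 else pw) := by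
  obtain ⟨st, hex, h⟩ : ∃ st, Exec w O (block loUpdBody) ⟨merge S H, qs⟩ st 7 ∧
      ∃ S' H', st = ⟨merge S' H', qs⟩ ∧
      (∀ i, i ≠ 71 → i ≠ 72 → i ≠ 73 → i ≠ 74 → S' i = S i) ∧ S' 71 = r ∧ S' 72 = p + 1 ∧
      S' 73 = q + 1 ∧ H' = Function.update H p (H p + if H q = pw then 0 else pw) := by
    refine Exec.block_of_fwd _ _ fun R hR => ?_
    unfold loUpdBody at hR
    have htmp := execOps_cons_fwd hR; clear hR; obtain ⟨v1, hv1, hR⟩ := htmp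
    simp -failIfUnchanged (disch := omega) only [Operand.write, Operand.read, merge_apply_of_lt,
      merge_apply_of_le, Function.update_self, Function.update_of_ne, update_merge_of_lt,
      update_merge_of_le, Nat.add_zero, Nat.zero_add, BinOp.eval_mod, BinOp.eval_eq, BinOp.eval_band,
      BinOp.eval_shr, BinOp.eval_div, BinOp.eval_lt, BinOp.eval_add_of_lt, BinOp.eval_sub_of_le,
      BinOp.eval_mul_of_lt, h40, h71, h72, h73] at hv1 hR
    have htmp := execOps_cons_fwd hR; clear hR; obtain ⟨v2, hv2, hR⟩ := htmp
    simp -failIfUnchanged (disch := omega) only [Operand.write, Operand.read, merge_apply_of_lt,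
      merge_apply_of_le, Function.update_self, Function.update_of_ne, update_merge_of_lt,
      update_merge_of_le, Nat.add_zero, Nat.zero_add, BinOp.eval_mod, BinOp.eval_eq, BinOp.eval_band,
      BinOp.eval_shr, BinOp.eval_div, BinOp.eval_lt, BinOp.eval_add_of_lt, BinOp.eval_sub_of_le,
      BinOp.eval_mul_of_lt, h40, h71, h72, h73] at hv2 hR
    rw [← hv1, flag_sub_ne hfd hpw] at hv2
    have h3 : v2 * pw ≤ pw := by
      rw [← hv2]; split_ifs <;> simp
    have h3' : v2 * pw = if H q = pw then 0 else pw := by rw [← hv2]; split_ifs <;> simp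
    have htmp := execOps_cons_fwd hR; clear hR; obtain ⟨v3, hv3, hR⟩ := htmp
    simp -failIfUnchanged (disch := omega) only [Operand.write, Operand.read, merge_apply_of_lt,
      merge_apply_of_le, Function.update_self, Function.update_of_ne, update_merge_of_lt,
      update_merge_of_le, Nat.add_zero, Nat.zero_add, BinOp.eval_mod, BinOp.eval_eq, BinOp.eval_band,
      BinOp.eval_shr, BinOp.eval_div, BinOp.eval_lt, BinOp.eval_add_of_lt, BinOp.eval_sub_of_le,
      BinOp.eval_mul_of_lt, h40, h71, h72, h73] at hv3 hR
    have htmp := execOps_cons_fwd hR; clear hR; obtain ⟨v4, hv4, hR⟩ := htmp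
    simp -failIfUnchanged (disch := omega) only [Operand.write, Operand.read, merge_apply_of_lt,
      merge_apply_of_le, Function.update_self, Function.update_of_ne, update_merge_of_lt,
      update_merge_of_le, Nat.add_zero, Nat.zero_add, BinOp.eval_mod, BinOp.eval_eq, BinOp.eval_band,
      BinOp.eval_shr, BinOp.eval_div, BinOp.eval_lt, BinOp.eval_add_of_lt, BinOp.eval_sub_of_le,
      BinOp.eval_mul_of_lt, h40, h71, h72, h73] at hv4 hR
    have htmp := execOps_cons_fwd hR; clear hR; obtain ⟨v5, hv5, hR⟩ := htmp
    simp -failIfUnchanged (disch := omega) only [Operand.write, Operand.read, merge_apply_of_lt,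
      merge_apply_of_le, Function.update_self, Function.update_of_ne, update_merge_of_lt,
      update_merge_of_le, Nat.add_zero, Nat.zero_add, BinOp.eval_mod, BinOp.eval_eq, BinOp.eval_band,
      BinOp.eval_shr, BinOp.eval_div, BinOp.eval_lt, BinOp.eval_add_of_lt, BinOp.eval_sub_of_le,
      BinOp.eval_mul_of_lt, h40, h71, h72, h73] at hv5 hR
    have htmp := execOps_cons_fwd hR; clear hR; obtain ⟨v6, hv6, hR⟩ := htmp
    simp -failIfUnchanged (disch := omega) only [Operand.write, Operand.read, merge_apply_of_lt,
      merge_apply_of_le, Function.update_self, Function.update_of_ne, update_merge_of_lt,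
      update_merge_of_le, Nat.add_zero, Nat.zero_add, BinOp.eval_mod, BinOp.eval_eq, BinOp.eval_band,
      BinOp.eval_shr, BinOp.eval_div, BinOp.eval_lt, BinOp.eval_add_of_lt, BinOp.eval_sub_of_le,
      BinOp.eval_mul_of_lt, h40, h71, h72, h73] at hv6 hR
    have htmp := execOps_cons_fwd hR; clear hR; obtain ⟨v7, hv7, hR⟩ := htmp
    simp -failIfUnchanged (disch := omega) only [Operand.write, Operand.read, merge_apply_of_lt,
      merge_apply_of_le, Function.update_self, Function.update_of_ne, update_merge_of_lt,
      update_merge_of_le, Nat.add_zero, Nat.zero_add, BinOp.eval_mod, BinOp.eval_eq, BinOp.eval_band,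
      BinOp.eval_shr, BinOp.eval_div, BinOp.eval_lt, BinOp.eval_add_of_lt, BinOp.eval_sub_of_le,
      BinOp.eval_mul_of_lt, h40, h71, h72, h73] at hv7 hR
    simp only [execOps_nil] at hR; subst hR
    subst hv7 hv6 hv5 hv4 hv3
    refine ⟨_, _, rfl, fun i a b c d => by simp [Function.update_of_ne, a, b, c, d], by simp, by simp,
      by simp, by rw [h3']⟩
  obtain ⟨S', H', rfl, h⟩ := h
  exact ⟨S', H', hex, h⟩

/-- **Semantics of the update loop** (with its three initial assignments): for every `t < n²`,
`lo[t] += pw [fd[t] ≠ pw]`; nothing else in the data changes; `9 n² + 4` steps. [folklore] -/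
theorem loUpd_spec {w : ℕ} {O : List ℕ → List ℕ} {n F pw B : ℕ} {S H : ℕ → ℕ} {qs : List (List ℕ)}
    (h9 : S 9 = F) (h30 : S 30 = F + n * n) (h35 : S 35 = n * n) (h40 : S 40 = pw)
    (hF : 100 ≤ F) (hpw : pw < 2 ^ w) (hlo : ∀ t, t < n * n → H (F + t) + pw ≤ B) (hB : B < 2 ^ w)
    (hfd : ∀ t, t < n * n → H (F + n * n + t) < 2 ^ w) (hcap : F + 2 * (n * n) + 1 < 2 ^ w) :
    ∃ S' H', ExecLE w O loUpd ⟨merge S H, qs⟩ ⟨merge S' H', qs⟩ (3 + (n * n * 9 + 1)) ∧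
      (∀ i, i ≠ 71 → i ≠ 72 → i ≠ 73 → i ≠ 74 → S' i = S i) ∧
      (∀ t, t < n * n → H' (F + t) = H (F + t) + if H (F + n * n + t) = pw then 0 else pw) ∧
      (∀ a, a < F ∨ F + n * n ≤ a → H' a = H a) := by
  unfold loUpd
  -- the three assignments
  obtain ⟨st₁, hex₁, S₁, rfl, hS₁, h71₁, h72₁, h73₁⟩ : ∃ st₁, Exec w O
      (block [(.add, .dir 71, .dir 35, .imm 0), (.add, .dir 72, .dir 9, .imm 0), (.add, .dir 73, .dir 30, .imm 0)])
      ⟨merge S H, qs⟩ st₁ 3 ∧ ∃ S₁, st₁ = ⟨merge S₁ H, qs⟩ ∧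
      (∀ i, i ≠ 71 → i ≠ 72 → i ≠ 73 → i ≠ 74 → S₁ i = S i) ∧ S₁ 71 = n * n ∧ S₁ 72 = F ∧
      S₁ 73 = F + n * n := by
    refine Exec.block_of_fwd _ _ fun R hR => ?_
    have htmp := execOps_cons_fwd hR; clear hR; obtain ⟨v1, hv1, hR⟩ := htmp
    simp -failIfUnchanged (disch := omega) only [Operand.write, Operand.read, merge_apply_of_lt,
      merge_apply_of_le, Function.update_self, Function.update_of_ne, update_merge_of_lt,
      update_merge_of_le, Nat.add_zero, Nat.zero_add, BinOp.eval_mod, BinOp.eval_eq, BinOp.eval_band,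
      BinOp.eval_shr, BinOp.eval_div, BinOp.eval_lt, BinOp.eval_add_of_lt, BinOp.eval_sub_of_le,
      BinOp.eval_mul_of_lt, h9, h30, h35] at hv1 hR
    have htmp := execOps_cons_fwd hR; clear hR; obtain ⟨v2, hv2, hR⟩ := htmp
    simp -failIfUnchanged (disch := omega) only [Operand.write, Operand.read, merge_apply_of_lt,
      merge_apply_of_le, Function.update_self, Function.update_of_ne, update_merge_of_lt,
      update_merge_of_le, Nat.add_zero, Nat.zero_add, BinOp.eval_mod, BinOp.eval_eq, BinOp.eval_band,
      BinOp.eval_shr, BinOp.eval_div, BinOp.eval_lt, BinOp.eval_add_of_lt, BinOp.eval_sub_of_le,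
      BinOp.eval_mul_of_lt, h9, h30, h35] at hv2 hR
    have htmp := execOps_cons_fwd hR; clear hR; obtain ⟨v3, hv3, hR⟩ := htmp
    simp -failIfUnchanged (disch := omega) only [Operand.write, Operand.read, merge_apply_of_lt,
      merge_apply_of_le, Function.update_self, Function.update_of_ne, update_merge_of_lt,
      update_merge_of_le, Nat.add_zero, Nat.zero_add, BinOp.eval_mod, BinOp.eval_eq, BinOp.eval_band,
      BinOp.eval_shr, BinOp.eval_div, BinOp.eval_lt, BinOp.eval_add_of_lt, BinOp.eval_sub_of_le,
      BinOp.eval_mul_of_lt, h9, h30, h35] at hv3 hR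
    simp only [execOps_nil] at hR; subst hR; subst hv1 hv2 hv3
    exact ⟨_, rfl, fun i a b c _ => by simp [Function.update_of_ne, a, b, c], by simp, by simp, by simp⟩
  have h40₁ : S₁ 40 = pw := (hS₁ 40 (by omega) (by omega) (by omega) (by omega)).trans h40
  -- the loop
  obtain ⟨st', hex, S', H', rfl, hS', -, -, -, hw, hnw⟩ := ExecLE.whilenz_invariant (w := w) (O := O)
    (x := .dir 71) (s := block loUpdBody) (n * n) 7
    (fun i st => ∃ S' H', st = ⟨merge S' H', qs⟩ ∧ (∀ j, j ≠ 71 → j ≠ 72 → j ≠ 73 → j ≠ 74 → S' j = S j) ∧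
      S' 71 = n * n - i ∧ S' 72 = F + i ∧ S' 73 = F + n * n + i ∧
      (∀ t, t < i → H' (F + t) = H (F + t) + if H (F + n * n + t) = pw then 0 else pw) ∧
      (∀ a, a < F ∨ F + i ≤ a → H' a = H a))
    (fun i hi st ⟨S', H', hst, hS', h71', h72', h73', hw, hnw⟩ => by
      subst hst
      refine ⟨by rw [Operand.read_dir_merge (by norm_num), h71']; omega, ?_⟩
      have hHp : H' (F + i) = H (F + i) := hnw _ (Or.inr le_rfl)
      have hHq : H' (F + n * n + i) = H (F + n * n + i) := hnw _ (Or.inr (by omega))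
      obtain ⟨S'', H'', hex, hS'', h71'', h72'', h73'', hH''⟩ := loUpd_iter (O := O) (qs := qs) (B := B)
        (H := H') (r := n * n - i - 1) ((hS' 40 (by omega) (by omega) (by omega) (by omega)).trans h40)
        (by rw [h71']; omega) h72' h73' (by omega) (by omega) hpw
        (by rw [hHp]; exact hlo i hi) hB (by rw [hHq]; exact hfd i hi) (by omega) (by omega)
      refine ⟨_, hex.execLE, S'', H'', rfl, fun j a b c d => (hS'' j a b c d).trans (hS' j a b c d),
        by rw [h71'']; omega, by rw [h72'']; omega, by rw [h73'']; omega, fun t ht => ?_, fun a ha => ?_⟩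
      · rw [hH'']
        rcases Nat.lt_or_ge t i with hlt | hge
        · rw [Function.update_of_ne (by omega)]; exact hw t hlt
        · rw [show t = i by omega, Function.update_self, hHp, hHq]
      · rw [hH'', Function.update_of_ne (by omega)]; exact hnw a (by omega))
    (fun st ⟨S', H', hst, _, h71', _⟩ => by
      subst hst; rw [Operand.read_dir_merge (by norm_num), h71']; omega)
    ⟨S₁, H, rfl, hS₁, by rw [h71₁]; rfl, by rw [h72₁]; rfl, by rw [h73₁]; rfl, fun t ht => by omega,
      fun a _ => rfl⟩
  refine ⟨S', H', hex₁.execLE.seqs_cons (ExecLE.seqs_one hex), hS', fun t ht => hw t ht,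
    fun a ha => hnw a (by rcases ha with ha | ha <;> omega)⟩

/-! ## Decoding -/

/-- The decoded code of a searched value `v`: `0` (the code of `⊤`) above `4M`, otherwise the
zig-zag code of `v - 2M` (cf. `encode_of_tval`). [folklore] -/
theorem decode_val_eq (M2 M4 v : ℕ) :
    (zzCode v M2 * if v < M4 + 1 then 1 else 0) = if M4 < v then 0 else zzCode v M2 := by
  by_cases h : M4 < v
  · rw [if_neg (by omega), if_pos h, Nat.mul_zero]
  · rw [if_pos (by omega), if_neg h, Nat.mul_one]

/-- One iteration of the decoding loop: `mem[q] := decode (lo[p])`. [folklore] -/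
theorem decode_iter {w : ℕ} {O : List ℕ → List ℕ} {M2 M4 p q r : ℕ} {S H : ℕ → ℕ} {qs : List (List ℕ)}
    (h14 : S 14 = M4 + 1) (h15 : S 15 = M2 - 1) (h22 : S 22 = M2) (h71 : S 71 = r + 1) (h72 : S 72 = p)
    (h73 : S 73 = q) (hp : 100 ≤ p) (hq : 100 ≤ q) (hM2 : 1 ≤ M2) (hv : H p < 4 * M2)
    (hcapM : 16 * M2 + 4 < 2 ^ w) (hcap : p + r + 1 < 2 ^ w) (hcap' : q + r + 1 < 2 ^ w) :
    ∃ S' H', Exec w O (seqs [block decodeOps1, block decodeOps2]) ⟨merge S H, qs⟩ ⟨merge S' H', qs⟩ 18 ∧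
      (∀ i, i < 71 ∨ 78 < i → S' i = S i) ∧ S' 71 = r ∧ S' 72 = p + 1 ∧ S' 73 = q + 1 ∧
      H' = Function.update H q (if M4 < H p then 0 else zzCode (H p) M2) := by
  set v := H p with hvdef
  -- block 1
  obtain ⟨st₁, hex₁, S₁, rfl, hS₁, h74₁, h76₁, h77₁, h78₁⟩ : ∃ st₁, Exec w O (block decodeOps1)
      ⟨merge S H, qs⟩ st₁ 9 ∧ ∃ S₁, st₁ = ⟨merge S₁ H, qs⟩ ∧
      (∀ i, i < 74 ∨ 78 < i → S₁ i = S i) ∧ S₁ 74 = v ∧ S₁ 76 = (if M2 - 1 < v then 1 else 0) ∧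
      S₁ 77 = (M2 - v) ∧ S₁ 78 = (v - M2) := by
    refine Exec.block_of_fwd _ _ fun R hR => ?_
    unfold decodeOps1 at hR
    have htmp := execOps_cons_fwd hR; clear hR; obtain ⟨v1, hv1, hR⟩ := htmp
    simp -failIfUnchanged (disch := omega) only [Operand.write, Operand.read, merge_apply_of_lt,
      merge_apply_of_le, Function.update_self, Function.update_of_ne, update_merge_of_lt,
      update_merge_of_le, Nat.add_zero, Nat.zero_add, BinOp.eval_mod, BinOp.eval_eq, BinOp.eval_band,
      BinOp.eval_shr, BinOp.eval_div, BinOp.eval_lt, BinOp.eval_add_of_lt, BinOp.eval_sub_of_le,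
      BinOp.eval_mul_of_lt, h14, h15, h22, h71, h72, h73] at hv1 hR
    rw [← hvdef] at hv1; subst hv1
    have htmp := execOps_cons_fwd hR; clear hR; obtain ⟨v2, hv2, hR⟩ := htmp
    simp -failIfUnchanged (disch := omega) only [Operand.write, Operand.read, merge_apply_of_lt,
      merge_apply_of_le, Function.update_self, Function.update_of_ne, update_merge_of_lt,
      update_merge_of_le, Nat.add_zero, Nat.zero_add, BinOp.eval_mod, BinOp.eval_eq, BinOp.eval_band,
      BinOp.eval_shr, BinOp.eval_div, BinOp.eval_lt, BinOp.eval_add_of_lt, BinOp.eval_sub_of_le,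
      BinOp.eval_mul_of_lt, h14, h15, h22, h71, h72, h73] at hv2 hR
    have hv2' : v2 ≤ 1 := hv2 ▸ NegTriToAPSP.ite_le_one _
    have htmp := execOps_cons_fwd hR; clear hR; obtain ⟨v3, hv3, hR⟩ := htmp
    simp -failIfUnchanged (disch := omega) only [Operand.write, Operand.read, merge_apply_of_lt,
      merge_apply_of_le, Function.update_self, Function.update_of_ne, update_merge_of_lt,
      update_merge_of_le, Nat.add_zero, Nat.zero_add, BinOp.eval_mod, BinOp.eval_eq, BinOp.eval_band,
      BinOp.eval_shr, BinOp.eval_div, BinOp.eval_lt, BinOp.eval_add_of_lt, BinOp.eval_sub_of_le,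
      BinOp.eval_mul_of_lt, h14, h15, h22, h71, h72, h73] at hv3 hR
    have hv3' : v3 ≤ 1 := hv3 ▸ NegTriToAPSP.ite_le_one _
    have h4 : v * v2 ≤ v := by simpa using Nat.mul_le_mul_left v hv2'
    have htmp := execOps_cons_fwd hR; clear hR; obtain ⟨v4, hv4, hR⟩ := htmp
    simp -failIfUnchanged (disch := omega) only [Operand.write, Operand.read, merge_apply_of_lt,
      merge_apply_of_le, Function.update_self, Function.update_of_ne, update_merge_of_lt,
      update_merge_of_le, Nat.add_zero, Nat.zero_add, BinOp.eval_mod, BinOp.eval_eq, BinOp.eval_band,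
      BinOp.eval_shr, BinOp.eval_div, BinOp.eval_lt, BinOp.eval_add_of_lt, BinOp.eval_sub_of_le,
      BinOp.eval_mul_of_lt, h14, h15, h22, h71, h72, h73] at hv4 hR
    have h5 : v4 ≤ M2 := by
      rw [← hv4, ← hv2]; split_ifs
      · simp; omega
      · simp
    have htmp := execOps_cons_fwd hR; clear hR; obtain ⟨v5, hv5, hR⟩ := htmp
    simp -failIfUnchanged (disch := omega) only [Operand.write, Operand.read, merge_apply_of_lt,
      merge_apply_of_le, Function.update_self, Function.update_of_ne, update_merge_of_lt,
      update_merge_of_le, Nat.add_zero, Nat.zero_add, BinOp.eval_mod, BinOp.eval_eq, BinOp.eval_band,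
      BinOp.eval_shr, BinOp.eval_div, BinOp.eval_lt, BinOp.eval_add_of_lt, BinOp.eval_sub_of_le,
      BinOp.eval_mul_of_lt, h14, h15, h22, h71, h72, h73] at hv5 hR
    have h6 : v5 * v2 ≤ v5 := by simpa using Nat.mul_le_mul_left v5 hv2'
    have htmp := execOps_cons_fwd hR; clear hR; obtain ⟨v6, hv6, hR⟩ := htmp
    simp -failIfUnchanged (disch := omega) only [Operand.write, Operand.read, merge_apply_of_lt,
      merge_apply_of_le, Function.update_self, Function.update_of_ne, update_merge_of_lt,
      update_merge_of_le, Nat.add_zero, Nat.zero_add, BinOp.eval_mod, BinOp.eval_eq, BinOp.eval_band,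
      BinOp.eval_shr, BinOp.eval_div, BinOp.eval_lt, BinOp.eval_add_of_lt, BinOp.eval_sub_of_le,
      BinOp.eval_mul_of_lt, h14, h15, h22, h71, h72, h73] at hv6 hR
    have h7 : M2 * v3 ≤ M2 := by simpa using Nat.mul_le_mul_left M2 hv3'
    have htmp := execOps_cons_fwd hR; clear hR; obtain ⟨v7, hv7, hR⟩ := htmp
    simp -failIfUnchanged (disch := omega) only [Operand.write, Operand.read, merge_apply_of_lt,
      merge_apply_of_le, Function.update_self, Function.update_of_ne, update_merge_of_lt,
      update_merge_of_le, Nat.add_zero, Nat.zero_add, BinOp.eval_mod, BinOp.eval_eq, BinOp.eval_band,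
      BinOp.eval_shr, BinOp.eval_div, BinOp.eval_lt, BinOp.eval_add_of_lt, BinOp.eval_sub_of_le,
      BinOp.eval_mul_of_lt, h14, h15, h22, h71, h72, h73] at hv7 hR
    have h8 : v7 ≤ v := by rw [← hv7, ← hv3]; split_ifs <;> simp; omega
    have htmp := execOps_cons_fwd hR; clear hR; obtain ⟨v8, hv8, hR⟩ := htmp
    simp -failIfUnchanged (disch := omega) only [Operand.write, Operand.read, merge_apply_of_lt,
      merge_apply_of_le, Function.update_self, Function.update_of_ne, update_merge_of_lt,
      update_merge_of_le, Nat.add_zero, Nat.zero_add, BinOp.eval_mod, BinOp.eval_eq, BinOp.eval_band,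
      BinOp.eval_shr, BinOp.eval_div, BinOp.eval_lt, BinOp.eval_add_of_lt, BinOp.eval_sub_of_le,
      BinOp.eval_mul_of_lt, h14, h15, h22, h71, h72, h73] at hv8 hR
    have h9 : v8 * v3 ≤ v8 := by simpa using Nat.mul_le_mul_left v8 hv3'
    have htmp := execOps_cons_fwd hR; clear hR; obtain ⟨v9, hv9, hR⟩ := htmp
    simp -failIfUnchanged (disch := omega) only [Operand.write, Operand.read, merge_apply_of_lt,
      merge_apply_of_le, Function.update_self, Function.update_of_ne, update_merge_of_lt,
      update_merge_of_le, Nat.add_zero, Nat.zero_add, BinOp.eval_mod, BinOp.eval_eq, BinOp.eval_band,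
      BinOp.eval_shr, BinOp.eval_div, BinOp.eval_lt, BinOp.eval_add_of_lt, BinOp.eval_sub_of_le,
      BinOp.eval_mul_of_lt, h14, h15, h22, h71, h72, h73] at hv9 hR
    simp only [execOps_nil] at hR; subst hR
    subst hv9 hv8 hv7 hv6 hv5 hv4 hv3 hv2
    refine ⟨_, rfl, fun i hi => ?_, ?_, ?_, ?_, ?_⟩
    · rcases hi with hi | hi <;> simp only [Function.update_of_ne, ne_eq, not_false_eq_true,
        show i ≠ 74 by omega, show i ≠ 75 by omega, show i ≠ 76 by omega, show i ≠ 77 by omega,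
        show i ≠ 78 by omega]
    · simp [Function.update_of_ne, Function.update_self]
    · simp [Function.update_of_ne, Function.update_self]
    · simp only [Function.update_of_ne, Function.update_self, ne_eq, Nat.reduceEqDiff, not_false_eq_true]
      by_cases hb : v < M2
      · rw [if_pos hb]; simp
      · rw [if_neg hb]; simp; omega
    · simp only [Function.update_of_ne, Function.update_self, ne_eq, Nat.reduceEqDiff, not_false_eq_true]
      by_cases hb : M2 - 1 < v
      · rw [if_pos hb]; simp
      · rw [if_neg hb]; simp; omega
  have h14₁ : S₁ 14 = M4 + 1 := (hS₁ 14 (by omega)).trans h14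
  have h71₁ : S₁ 71 = r + 1 := (hS₁ 71 (by omega)).trans h71
  have h72₁ : S₁ 72 = p := (hS₁ 72 (by omega)).trans h72
  have h73₁ : S₁ 73 = q := (hS₁ 73 (by omega)).trans h73
  set nb := (if M2 - 1 < v then 1 else 0) with hnb
  have hnb1 : nb ≤ 1 := by rw [hnb]; exact NegTriToAPSP.ite_le_one _
  -- block 2
  obtain ⟨st₂, hex₂, S₂, H₂, rfl, hS₂, h71₂, h72₂, h73₂, hH₂⟩ : ∃ st₂, Exec w O (block decodeOps2)
      ⟨merge S₁ H, qs⟩ st₂ 9 ∧ ∃ S₂ H₂, st₂ = ⟨merge S₂ H₂, qs⟩ ∧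
      (∀ i, i < 71 ∨ 78 < i → S₂ i = S₁ i) ∧ S₂ 71 = r ∧ S₂ 72 = p + 1 ∧ S₂ 73 = q + 1 ∧
      H₂ = Function.update H q ((2 * ((M2 - v) + (v - M2)) + nb) * if v < M4 + 1 then 1 else 0) := by
    refine Exec.block_of_fwd _ _ fun R hR => ?_
    unfold decodeOps2 at hR
    have htmp := execOps_cons_fwd hR; clear hR; obtain ⟨v1, hv1, hR⟩ := htmp
    simp -failIfUnchanged (disch := omega) only [Operand.write, Operand.read, merge_apply_of_lt,
      merge_apply_of_le, Function.update_self, Function.update_of_ne, update_merge_of_lt,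
      update_merge_of_le, Nat.add_zero, Nat.zero_add, BinOp.eval_mod, BinOp.eval_eq, BinOp.eval_band,
      BinOp.eval_shr, BinOp.eval_div, BinOp.eval_lt, BinOp.eval_add_of_lt, BinOp.eval_sub_of_le,
      BinOp.eval_mul_of_lt, h14₁, h73₁, h74₁, h76₁, h77₁, h78₁, h72₁, h71₁] at hv1 hR
    have htmp := execOps_cons_fwd hR; clear hR; obtain ⟨v2, hv2, hR⟩ := htmp
    simp -failIfUnchanged (disch := omega) only [Operand.write, Operand.read, merge_apply_of_lt,
      merge_apply_of_le, Function.update_self, Function.update_of_ne, update_merge_of_lt,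
      update_merge_of_le, Nat.add_zero, Nat.zero_add, BinOp.eval_mod, BinOp.eval_eq, BinOp.eval_band,
      BinOp.eval_shr, BinOp.eval_div, BinOp.eval_lt, BinOp.eval_add_of_lt, BinOp.eval_sub_of_le,
      BinOp.eval_mul_of_lt, h14₁, h73₁, h74₁, h76₁, h77₁, h78₁, h72₁, h71₁] at hv2 hR
    have htmp := execOps_cons_fwd hR; clear hR; obtain ⟨v3, hv3, hR⟩ := htmp
    simp -failIfUnchanged (disch := omega) only [Operand.write, Operand.read, merge_apply_of_lt,
      merge_apply_of_le, Function.update_self, Function.update_of_ne, update_merge_of_lt,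
      update_merge_of_le, Nat.add_zero, Nat.zero_add, BinOp.eval_mod, BinOp.eval_eq, BinOp.eval_band,
      BinOp.eval_shr, BinOp.eval_div, BinOp.eval_lt, BinOp.eval_add_of_lt, BinOp.eval_sub_of_le,
      BinOp.eval_mul_of_lt, h14₁, h73₁, h74₁, h76₁, h77₁, h78₁, h72₁, h71₁] at hv3 hR
    have htmp := execOps_cons_fwd hR; clear hR; obtain ⟨v4, hv4, hR⟩ := htmp
    simp -failIfUnchanged (disch := omega) only [Operand.write, Operand.read, merge_apply_of_lt,
      merge_apply_of_le, Function.update_self, Function.update_of_ne, update_merge_of_lt,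
      update_merge_of_le, Nat.add_zero, Nat.zero_add, BinOp.eval_mod, BinOp.eval_eq, BinOp.eval_band,
      BinOp.eval_shr, BinOp.eval_div, BinOp.eval_lt, BinOp.eval_add_of_lt, BinOp.eval_sub_of_le,
      BinOp.eval_mul_of_lt, h14₁, h73₁, h74₁, h76₁, h77₁, h78₁, h72₁, h71₁] at hv4 hR
    have hv4' : v4 ≤ 1 := hv4 ▸ NegTriToAPSP.ite_le_one _
    have h5 : v3 * v4 ≤ v3 := by simpa using Nat.mul_le_mul_left v3 hv4'
    have htmp := execOps_cons_fwd hR; clear hR; obtain ⟨v5, hv5, hR⟩ := htmp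
    simp -failIfUnchanged (disch := omega) only [Operand.write, Operand.read, merge_apply_of_lt,
      merge_apply_of_le, Function.update_self, Function.update_of_ne, update_merge_of_lt,
      update_merge_of_le, Nat.add_zero, Nat.zero_add, BinOp.eval_mod, BinOp.eval_eq, BinOp.eval_band,
      BinOp.eval_shr, BinOp.eval_div, BinOp.eval_lt, BinOp.eval_add_of_lt, BinOp.eval_sub_of_le,
      BinOp.eval_mul_of_lt, h14₁, h73₁, h74₁, h76₁, h77₁, h78₁, h72₁, h71₁] at hv5 hR
    have htmp := execOps_cons_fwd hR; clear hR; obtain ⟨v6, hv6, hR⟩ := htmp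
    simp -failIfUnchanged (disch := omega) only [Operand.write, Operand.read, merge_apply_of_lt,
      merge_apply_of_le, Function.update_self, Function.update_of_ne, update_merge_of_lt,
      update_merge_of_le, Nat.add_zero, Nat.zero_add, BinOp.eval_mod, BinOp.eval_eq, BinOp.eval_band,
      BinOp.eval_shr, BinOp.eval_div, BinOp.eval_lt, BinOp.eval_add_of_lt, BinOp.eval_sub_of_le,
      BinOp.eval_mul_of_lt, h14₁, h73₁, h74₁, h76₁, h77₁, h78₁, h72₁, h71₁] at hv6 hR
    have htmp := execOps_cons_fwd hR; clear hR; obtain ⟨v7, hv7, hR⟩ := htmp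
    simp -failIfUnchanged (disch := omega) only [Operand.write, Operand.read, merge_apply_of_lt,
      merge_apply_of_le, Function.update_self, Function.update_of_ne, update_merge_of_lt,
      update_merge_of_le, Nat.add_zero, Nat.zero_add, BinOp.eval_mod, BinOp.eval_eq, BinOp.eval_band,
      BinOp.eval_shr, BinOp.eval_div, BinOp.eval_lt, BinOp.eval_add_of_lt, BinOp.eval_sub_of_le,
      BinOp.eval_mul_of_lt, h14₁, h73₁, h74₁, h76₁, h77₁, h78₁, h72₁, h71₁] at hv7 hR
    have htmp := execOps_cons_fwd hR; clear hR; obtain ⟨v8, hv8, hR⟩ := htmp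
    simp -failIfUnchanged (disch := omega) only [Operand.write, Operand.read, merge_apply_of_lt,
      merge_apply_of_le, Function.update_self, Function.update_of_ne, update_merge_of_lt,
      update_merge_of_le, Nat.add_zero, Nat.zero_add, BinOp.eval_mod, BinOp.eval_eq, BinOp.eval_band,
      BinOp.eval_shr, BinOp.eval_div, BinOp.eval_lt, BinOp.eval_add_of_lt, BinOp.eval_sub_of_le,
      BinOp.eval_mul_of_lt, h14₁, h73₁, h74₁, h76₁, h77₁, h78₁, h72₁, h71₁] at hv8 hR
    have htmp := execOps_cons_fwd hR; clear hR; obtain ⟨v9, hv9, hR⟩ := htmp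
    simp -failIfUnchanged (disch := omega) only [Operand.write, Operand.read, merge_apply_of_lt,
      merge_apply_of_le, Function.update_self, Function.update_of_ne, update_merge_of_lt,
      update_merge_of_le, Nat.add_zero, Nat.zero_add, BinOp.eval_mod, BinOp.eval_eq, BinOp.eval_band,
      BinOp.eval_shr, BinOp.eval_div, BinOp.eval_lt, BinOp.eval_add_of_lt, BinOp.eval_sub_of_le,
      BinOp.eval_mul_of_lt, h14₁, h73₁, h74₁, h76₁, h77₁, h78₁, h72₁, h71₁] at hv9 hR
    simp only [execOps_nil] at hR; subst hR
    subst hv9 hv8 hv7 hv6 hv5 hv4 hv3 hv2 hv1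
    refine ⟨_, _, rfl, fun i hi => ?_, ?_, ?_, ?_, ?_⟩
    · rcases hi with hi | hi <;> simp only [Function.update_of_ne, ne_eq, not_false_eq_true,
        show i ≠ 71 by omega, show i ≠ 72 by omega, show i ≠ 73 by omega, show i ≠ 77 by omega,
        show i ≠ 78 by omega]
    · simp [Function.update_of_ne, Function.update_self]
    · simp [Function.update_of_ne, Function.update_self]
    · simp [Function.update_of_ne, Function.update_self]
    · congr 1; ring
  refine ⟨S₂, H₂, hex₁.seqs_cons (Exec.seqs_one hex₂), fun i hi => (hS₂ i hi).trans (hS₁ i (by omega)),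
    h71₂, h72₂, h73₂, ?_⟩
  rw [hH₂, ← decode_val_eq M2 M4 v]
  congr 2
  rw [zzCode, hnb, Nat.add_comm (M2 - v)]
  congr 1
  by_cases hb : M2 - 1 < v
  · rw [if_pos hb, if_pos (by omega)]
  · rw [if_neg hb, if_neg (by omega)]

/-- **Semantics of the decoding loop** (with its three initial assignments): for every `t < n²` the
code decoded from `lo[t]` is written over entry `t` of the `X` block; `21 n² + 4` steps. [folklore] -/
theorem decode_spec {w : ℕ} {O : List ℕ → List ℕ} {n F pX M2 M4 : ℕ} {S H : ℕ → ℕ} {qs : List (List ℕ)}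
    (h9 : S 9 = F) (h14 : S 14 = M4 + 1) (h15 : S 15 = M2 - 1) (h16 : S 16 = pX) (h22 : S 22 = M2)
    (h35 : S 35 = n * n) (hpX : 100 ≤ pX) (hXF : pX + n * n < F) (hM2 : 1 ≤ M2)
    (hlo : ∀ t, t < n * n → H (F + t) < 4 * M2) (hcapM : 16 * M2 + 4 < 2 ^ w) (hcap : F + n * n + 1 < 2 ^ w) :
    ∃ S' H', ExecLE w O decode ⟨merge S H, qs⟩ ⟨merge S' H', qs⟩ (3 + (n * n * 20 + 1)) ∧
      (∀ i, i < 71 ∨ 78 < i → S' i = S i) ∧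
      (∀ t, t < n * n → H' (pX + 1 + t) = if M4 < H (F + t) then 0 else zzCode (H (F + t)) M2) ∧
      (∀ a, a < pX + 1 ∨ pX + 1 + n * n ≤ a → H' a = H a) := by
  unfold decode
  -- the three assignments
  obtain ⟨st₁, hex₁, S₁, rfl, hS₁, h71₁, h72₁, h73₁⟩ : ∃ st₁, Exec w O
      (block [(.add, .dir 71, .dir 35, .imm 0), (.add, .dir 72, .dir 9, .imm 0), (.add, .dir 73, .dir 16, .imm 1)])
      ⟨merge S H, qs⟩ st₁ 3 ∧ ∃ S₁, st₁ = ⟨merge S₁ H, qs⟩ ∧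
      (∀ i, i < 71 ∨ 78 < i → S₁ i = S i) ∧ S₁ 71 = n * n ∧ S₁ 72 = F ∧ S₁ 73 = pX + 1 := by
    refine Exec.block_of_fwd _ _ fun R hR => ?_
    have htmp := execOps_cons_fwd hR; clear hR; obtain ⟨v1, hv1, hR⟩ := htmp
    simp -failIfUnchanged (disch := omega) only [Operand.write, Operand.read, merge_apply_of_lt,
      merge_apply_of_le, Function.update_self, Function.update_of_ne, update_merge_of_lt,
      update_merge_of_le, Nat.add_zero, Nat.zero_add, BinOp.eval_mod, BinOp.eval_eq, BinOp.eval_band,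
      BinOp.eval_shr, BinOp.eval_div, BinOp.eval_lt, BinOp.eval_add_of_lt, BinOp.eval_sub_of_le,
      BinOp.eval_mul_of_lt, h9, h16, h35] at hv1 hR
    have htmp := execOps_cons_fwd hR; clear hR; obtain ⟨v2, hv2, hR⟩ := htmp
    simp -failIfUnchanged (disch := omega) only [Operand.write, Operand.read, merge_apply_of_lt,
      merge_apply_of_le, Function.update_self, Function.update_of_ne, update_merge_of_lt,
      update_merge_of_le, Nat.add_zero, Nat.zero_add, BinOp.eval_mod, BinOp.eval_eq, BinOp.eval_band,
      BinOp.eval_shr, BinOp.eval_div, BinOp.eval_lt, BinOp.eval_add_of_lt, BinOp.eval_sub_of_le,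
      BinOp.eval_mul_of_lt, h9, h16, h35] at hv2 hR
    have htmp := execOps_cons_fwd hR; clear hR; obtain ⟨v3, hv3, hR⟩ := htmp
    simp -failIfUnchanged (disch := omega) only [Operand.write, Operand.read, merge_apply_of_lt,
      merge_apply_of_le, Function.update_self, Function.update_of_ne, update_merge_of_lt,
      update_merge_of_le, Nat.add_zero, Nat.zero_add, BinOp.eval_mod, BinOp.eval_eq, BinOp.eval_band,
      BinOp.eval_shr, BinOp.eval_div, BinOp.eval_lt, BinOp.eval_add_of_lt, BinOp.eval_sub_of_le,
      BinOp.eval_mul_of_lt, h9, h16, h35] at hv3 hR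
    simp only [execOps_nil] at hR; subst hR; subst hv1 hv2 hv3
    refine ⟨_, rfl, fun i hi => ?_, by simp, by simp, by simp⟩
    rcases hi with hi | hi <;> simp only [Function.update_of_ne, ne_eq, not_false_eq_true,
      show i ≠ 71 by omega, show i ≠ 72 by omega, show i ≠ 73 by omega]
  -- the loop
  obtain ⟨st', hex, S', H', rfl, hS', -, -, -, hw, hnw⟩ := ExecLE.whilenz_invariant (w := w) (O := O)
    (x := .dir 71) (s := seqs [block decodeOps1, block decodeOps2]) (n * n) 18
    (fun i st => ∃ S' H', st = ⟨merge S' H', qs⟩ ∧ (∀ j, j < 71 ∨ 78 < j → S' j = S j) ∧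
      S' 71 = n * n - i ∧ S' 72 = F + i ∧ S' 73 = pX + 1 + i ∧
      (∀ t, t < i → H' (pX + 1 + t) = if M4 < H (F + t) then 0 else zzCode (H (F + t)) M2) ∧
      (∀ a, a < pX + 1 ∨ pX + 1 + i ≤ a → H' a = H a))
    (fun i hi st ⟨S', H', hst, hS', h71', h72', h73', hw, hnw⟩ => by
      subst hst
      refine ⟨by rw [Operand.read_dir_merge (by norm_num), h71']; omega, ?_⟩
      have hHp : H' (F + i) = H (F + i) := hnw _ (Or.inr (by omega))
      obtain ⟨S'', H'', hex, hS'', h71'', h72'', h73'', hH''⟩ := decode_iter (O := O) (qs := qs)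
        (H := H') (r := n * n - i - 1) ((hS' 14 (by omega)).trans h14) ((hS' 15 (by omega)).trans h15)
        ((hS' 22 (by omega)).trans h22) (by rw [h71']; omega) h72' h73' (by omega) (by omega) hM2
        (by rw [hHp]; exact hlo i hi) hcapM (by omega) (by omega)
      refine ⟨_, hex.execLE, S'', H'', rfl, fun j hj => (hS'' j hj).trans (hS' j hj),
        by rw [h71'']; omega, by rw [h72'']; omega, by rw [h73'']; omega, fun t ht => ?_, fun a ha => ?_⟩
      · rw [hH'']
        rcases Nat.lt_or_ge t i with hlt | hge
        · rw [Function.update_of_ne (by omega)]; exact hw t hlt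
        · rw [show t = i by omega, Function.update_self, hHp]
      · rw [hH'', Function.update_of_ne (by omega)]; exact hnw a (by omega))
    (fun st ⟨S', H', hst, _, h71', _⟩ => by
      subst hst; rw [Operand.read_dir_merge (by norm_num), h71']; omega)
    ⟨S₁, H, rfl, hS₁, by rw [h71₁]; rfl, by rw [h72₁]; rfl, by rw [h73₁], fun t ht => by omega,
      fun a _ => rfl⟩
  refine ⟨S', H', hex₁.execLE.seqs_cons (ExecLE.seqs_one hex), hS', fun t ht => hw t ht,
    fun a ha => hnw a (by rcases ha with ha | ha <;> omega)⟩

end Literature.Computability.FineGrained.NegTriSweep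

namespace Literature.Computability.FineGrained.NegTriSweep

open Cryptography Cryptography.WordRAM Cryptography.WordRAM.SProg APSPPower NegTriStep

set_option linter.unusedSimpArgs false

/-! ## Blocks of a triple: indices and parameters -/

/-- `nb L ≤ n + L - 1`. [folklore] -/
theorem cNB_mul_le (n : ℕ) : cNB n * cL n ≤ n + cL n - 1 := Nat.div_mul_le_self _ _

/-- A block offset is below `n`: `b < nb → b L < n` (for `n ≥ 1`). [folklore] -/
theorem block_mul_lt {n b : ℕ} (hn : 1 ≤ n) (hb : b < cNB n) : b * cL n < n := by
  have h1 : (b + 1) * cL n ≤ cNB n * cL n := Nat.mul_le_mul_right _ hb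
  have h2 := cNB_mul_le n
  have hL := one_le_cL n
  rw [Nat.succ_mul] at h1
  omega

/-- `nb ≤ n` (for `n ≥ 1`). [folklore] -/
theorem cNB_le (n : ℕ) (hn : 1 ≤ n) : cNB n ≤ n := by
  have hL := one_le_cL n
  have h1 : n + cL n ≤ n * cL n + 1 := by nlinarith
  unfold cNB
  calc (n + cL n - 1) / cL n ≤ (n * cL n) / cL n := Nat.div_le_div_right (by omega)
    _ = n := Nat.mul_div_cancel _ (by omega)

/-- `1 ≤ nb` (for `n ≥ 1`). [folklore] -/
theorem one_le_cNB {n : ℕ} (hn : 1 ≤ n) : 1 ≤ cNB n := by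
  have hL := one_le_cL n
  unfold cNB; exact Nat.div_pos (by omega) (by omega)

/-- **`tripleOps1`**: the indices `bi, bj, bk` of triple `t = r41 - 1` and the parameters of the
`X`-block copy. [folklore] -/
theorem tripleOps1_spec {w : ℕ} {O : List ℕ → List ℕ} {c n F pX tr : ℕ} {S H : ℕ → ℕ} {qs : List (List ℕ)}
    (hR : Regs c n F pX S) (h41 : S 41 = tr + 1) (hn : 1 ≤ n) (htr : tr < cNB n * cNB n * cNB n)
    (hcapNB : cNB n * cNB n * cNB n < 2 ^ w) (hcapW : F + wspNT n < 2 ^ w) (hXF : pX + n * n < F) :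
    ∃ st', Exec w O (block tripleOps1) ⟨merge S H, qs⟩ st' 10 ∧ ∃ S', st' = ⟨merge S' H, qs⟩ ∧
      (∀ i, i < 41 ∨ (44 < i ∧ i < 60) ∨ 64 < i → S' i = S i) ∧
      S' 41 = tr ∧ S' 42 = tr / (cNB n * cNB n) ∧ S' 43 = tr / cNB n % cNB n ∧ S' 44 = tr % cNB n ∧
      S' 60 = cL n * cL n ∧ S' 61 = pX + 1 ∧ S' 62 = tr / (cNB n * cNB n) * cL n ∧
      S' 63 = tr % cNB n * cL n ∧ S' 64 = F + 2 * (n * n) + 1 + cL n := by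
  have h16 := hR.r16; have h25 := hR.r25; have h26 := hR.r26; have h29 := hR.r29; have h34 := hR.r34
  have h39 := hR.r39
  have hNB1 := one_le_cNB hn
  have hNB2 : cNB n * cNB n ≤ cNB n * cNB n * cNB n := Nat.le_mul_of_pos_right _ hNB1
  have hbi : tr / (cNB n * cNB n) < cNB n := Nat.div_lt_of_lt_mul htr
  have hnn : n ≤ n * n := Nat.le_mul_self _
  have hbk : tr % cNB n < cNB n := Nat.mod_lt _ hNB1
  have hbiL : tr / (cNB n * cNB n) * cL n < n := block_mul_lt hn hbi
  have hbkL : tr % cNB n * cL n < n := block_mul_lt hn hbk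
  have hwsp : wspNT n = 2 * (n * n) + 9 * (cL n * cL n) + 3 := rfl
  have hLL' : cL n ≤ cL n * cL n := Nat.le_mul_self _
  have hnn' : n ≤ n * n := Nat.le_mul_self _
  refine Exec.block_of_fwd _ _ fun R hR => ?_
  unfold tripleOps1 at hR
  have htmp := execOps_cons_fwd hR; clear hR; obtain ⟨v1, hv1, hR⟩ := htmp
  simp -failIfUnchanged (disch := omega) only [Operand.write, Operand.read, merge_apply_of_lt,
    merge_apply_of_le, Function.update_self, Function.update_of_ne, update_merge_of_lt,
    update_merge_of_le, Nat.add_zero, Nat.zero_add, BinOp.eval_mod, BinOp.eval_eq, BinOp.eval_band,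
    BinOp.eval_shr, BinOp.eval_div, BinOp.eval_lt, BinOp.eval_add_of_lt, BinOp.eval_sub_of_le,
    BinOp.eval_mul_of_lt, h16, h25, h26, h29, h34, h39, h41] at hv1 hR
  simp only [Nat.add_sub_cancel] at hv1; subst hv1
  have htmp := execOps_cons_fwd hR; clear hR; obtain ⟨v2, hv2, hR⟩ := htmp
  simp -failIfUnchanged (disch := omega) only [Operand.write, Operand.read, merge_apply_of_lt,
    merge_apply_of_le, Function.update_self, Function.update_of_ne, update_merge_of_lt,
    update_merge_of_le, Nat.add_zero, Nat.zero_add, BinOp.eval_mod, BinOp.eval_eq, BinOp.eval_band,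
    BinOp.eval_shr, BinOp.eval_div, BinOp.eval_lt, BinOp.eval_add_of_lt, BinOp.eval_sub_of_le,
    BinOp.eval_mul_of_lt, h16, h25, h26, h29, h34, h39, h41] at hv2 hR
  subst hv2
  have htmp := execOps_cons_fwd hR; clear hR; obtain ⟨v3, hv3, hR⟩ := htmp
  simp -failIfUnchanged (disch := omega) only [Operand.write, Operand.read, merge_apply_of_lt,
    merge_apply_of_le, Function.update_self, Function.update_of_ne, update_merge_of_lt,
    update_merge_of_le, Nat.add_zero, Nat.zero_add, BinOp.eval_mod, BinOp.eval_eq, BinOp.eval_band,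
    BinOp.eval_shr, BinOp.eval_div, BinOp.eval_lt, BinOp.eval_add_of_lt, BinOp.eval_sub_of_le,
    BinOp.eval_mul_of_lt, h16, h25, h26, h29, h34, h39, h41] at hv3 hR
  have htmp := execOps_cons_fwd hR; clear hR; obtain ⟨v4, hv4, hR⟩ := htmp
  simp -failIfUnchanged (disch := omega) only [Operand.write, Operand.read, merge_apply_of_lt,
    merge_apply_of_le, Function.update_self, Function.update_of_ne, update_merge_of_lt,
    update_merge_of_le, Nat.add_zero, Nat.zero_add, BinOp.eval_mod, BinOp.eval_eq, BinOp.eval_band,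
    BinOp.eval_shr, BinOp.eval_div, BinOp.eval_lt, BinOp.eval_add_of_lt, BinOp.eval_sub_of_le,
    BinOp.eval_mul_of_lt, h16, h25, h26, h29, h34, h39, h41] at hv4 hR
  rw [← hv3] at hv4; subst hv4
  have htmp := execOps_cons_fwd hR; clear hR; obtain ⟨v5, hv5, hR⟩ := htmp
  simp -failIfUnchanged (disch := omega) only [Operand.write, Operand.read, merge_apply_of_lt,
    merge_apply_of_le, Function.update_self, Function.update_of_ne, update_merge_of_lt,
    update_merge_of_le, Nat.add_zero, Nat.zero_add, BinOp.eval_mod, BinOp.eval_eq, BinOp.eval_band,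
    BinOp.eval_shr, BinOp.eval_div, BinOp.eval_lt, BinOp.eval_add_of_lt, BinOp.eval_sub_of_le,
    BinOp.eval_mul_of_lt, h16, h25, h26, h29, h34, h39, h41] at hv5 hR
  subst hv5
  have htmp := execOps_cons_fwd hR; clear hR; obtain ⟨v6, hv6, hR⟩ := htmp
  simp -failIfUnchanged (disch := omega) only [Operand.write, Operand.read, merge_apply_of_lt,
    merge_apply_of_le, Function.update_self, Function.update_of_ne, update_merge_of_lt,
    update_merge_of_le, Nat.add_zero, Nat.zero_add, BinOp.eval_mod, BinOp.eval_eq, BinOp.eval_band,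
    BinOp.eval_shr, BinOp.eval_div, BinOp.eval_lt, BinOp.eval_add_of_lt, BinOp.eval_sub_of_le,
    BinOp.eval_mul_of_lt, h16, h25, h26, h29, h34, h39, h41] at hv6 hR
  have htmp := execOps_cons_fwd hR; clear hR; obtain ⟨v7, hv7, hR⟩ := htmp
  simp -failIfUnchanged (disch := omega) only [Operand.write, Operand.read, merge_apply_of_lt,
    merge_apply_of_le, Function.update_self, Function.update_of_ne, update_merge_of_lt,
    update_merge_of_le, Nat.add_zero, Nat.zero_add, BinOp.eval_mod, BinOp.eval_eq, BinOp.eval_band,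
    BinOp.eval_shr, BinOp.eval_div, BinOp.eval_lt, BinOp.eval_add_of_lt, BinOp.eval_sub_of_le,
    BinOp.eval_mul_of_lt, h16, h25, h26, h29, h34, h39, h41] at hv7 hR
  have htmp := execOps_cons_fwd hR; clear hR; obtain ⟨v8, hv8, hR⟩ := htmp
  simp -failIfUnchanged (disch := omega) only [Operand.write, Operand.read, merge_apply_of_lt,
    merge_apply_of_le, Function.update_self, Function.update_of_ne, update_merge_of_lt,
    update_merge_of_le, Nat.add_zero, Nat.zero_add, BinOp.eval_mod, BinOp.eval_eq, BinOp.eval_band,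
    BinOp.eval_shr, BinOp.eval_div, BinOp.eval_lt, BinOp.eval_add_of_lt, BinOp.eval_sub_of_le,
    BinOp.eval_mul_of_lt, h16, h25, h26, h29, h34, h39, h41] at hv8 hR
  have htmp := execOps_cons_fwd hR; clear hR; obtain ⟨v9, hv9, hR⟩ := htmp
  simp -failIfUnchanged (disch := omega) only [Operand.write, Operand.read, merge_apply_of_lt,
    merge_apply_of_le, Function.update_self, Function.update_of_ne, update_merge_of_lt,
    update_merge_of_le, Nat.add_zero, Nat.zero_add, BinOp.eval_mod, BinOp.eval_eq, BinOp.eval_band,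
    BinOp.eval_shr, BinOp.eval_div, BinOp.eval_lt, BinOp.eval_add_of_lt, BinOp.eval_sub_of_le,
    BinOp.eval_mul_of_lt, h16, h25, h26, h29, h34, h39, h41] at hv9 hR
  have htmp := execOps_cons_fwd hR; clear hR; obtain ⟨v10, hv10, hR⟩ := htmp
  simp -failIfUnchanged (disch := omega) only [Operand.write, Operand.read, merge_apply_of_lt,
    merge_apply_of_le, Function.update_self, Function.update_of_ne, update_merge_of_lt,
    update_merge_of_le, Nat.add_zero, Nat.zero_add, BinOp.eval_mod, BinOp.eval_eq, BinOp.eval_band,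
    BinOp.eval_shr, BinOp.eval_div, BinOp.eval_lt, BinOp.eval_add_of_lt, BinOp.eval_sub_of_le,
    BinOp.eval_mul_of_lt, h16, h25, h26, h29, h34, h39, h41] at hv10 hR
  simp only [execOps_nil] at hR; subst hR
  subst hv10 hv9 hv8 hv7 hv6 hv3
  refine ⟨_, rfl, fun i hi => ?_, ?_, ?_, ?_, ?_, ?_, ?_, ?_, ?_, ?_⟩
  · simp only [Function.update_of_ne, ne_eq, not_false_eq_true, show i ≠ 41 by omega,
      show i ≠ 42 by omega, show i ≠ 43 by omega, show i ≠ 44 by omega, show i ≠ 60 by omega,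
      show i ≠ 61 by omega, show i ≠ 62 by omega, show i ≠ 63 by omega, show i ≠ 64 by omega]
  all_goals simp [Function.update_of_ne, Function.update_self]

/-- **`tripleOps2`**: the parameters of the `Y`-block copy. [folklore] -/
theorem tripleOps2_spec {w : ℕ} {O : List ℕ → List ℕ} {c n F pX bj bk : ℕ} {S H : ℕ → ℕ} {qs : List (List ℕ)}
    (hR : Regs c n F pX S) (h43 : S 43 = bj) (h44 : S 44 = bk) (hbj : bj * cL n < n) (hbk : bk * cL n < n)
    (hcapW : F + wspNT n < 2 ^ w) (hXF : pX + n * n < F) :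
    ∃ st', Exec w O (block tripleOps2) ⟨merge S H, qs⟩ st' 5 ∧ ∃ S', st' = ⟨merge S' H, qs⟩ ∧
      (∀ i, i < 60 ∨ 64 < i → S' i = S i) ∧
      S' 60 = cL n * cL n ∧ S' 61 = pX + n * n + 1 + 1 ∧ S' 62 = bk * cL n ∧ S' 63 = bj * cL n ∧
      S' 64 = F + 2 * (n * n) + 1 + 3 * (cL n * cL n) + cL n + cL n := by
  have h17 := hR.r17; have h18 := hR.r18; have h25 := hR.r25; have h29 := hR.r29
  have hwsp : wspNT n = 2 * (n * n) + 9 * (cL n * cL n) + 3 := rfl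
  have hLL' : cL n ≤ cL n * cL n := Nat.le_mul_self _
  have hnn' : n ≤ n * n := Nat.le_mul_self _
  refine Exec.block_of_fwd _ _ fun R hR => ?_
  unfold tripleOps2 at hR
  have htmp := execOps_cons_fwd hR; clear hR; obtain ⟨v1, hv1, hR⟩ := htmp
  simp -failIfUnchanged (disch := omega) only [Operand.write, Operand.read, merge_apply_of_lt,
    merge_apply_of_le, Function.update_self, Function.update_of_ne, update_merge_of_lt,
    update_merge_of_le, Nat.add_zero, Nat.zero_add, BinOp.eval_mod, BinOp.eval_eq, BinOp.eval_band,
    BinOp.eval_shr, BinOp.eval_div, BinOp.eval_lt, BinOp.eval_add_of_lt, BinOp.eval_sub_of_le,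
    BinOp.eval_mul_of_lt, h17, h18, h25, h29, h43, h44] at hv1 hR
  have htmp := execOps_cons_fwd hR; clear hR; obtain ⟨v2, hv2, hR⟩ := htmp
  simp -failIfUnchanged (disch := omega) only [Operand.write, Operand.read, merge_apply_of_lt,
    merge_apply_of_le, Function.update_self, Function.update_of_ne, update_merge_of_lt,
    update_merge_of_le, Nat.add_zero, Nat.zero_add, BinOp.eval_mod, BinOp.eval_eq, BinOp.eval_band,
    BinOp.eval_shr, BinOp.eval_div, BinOp.eval_lt, BinOp.eval_add_of_lt, BinOp.eval_sub_of_le,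
    BinOp.eval_mul_of_lt, h17, h18, h25, h29, h43, h44] at hv2 hR
  have htmp := execOps_cons_fwd hR; clear hR; obtain ⟨v3, hv3, hR⟩ := htmp
  simp -failIfUnchanged (disch := omega) only [Operand.write, Operand.read, merge_apply_of_lt,
    merge_apply_of_le, Function.update_self, Function.update_of_ne, update_merge_of_lt,
    update_merge_of_le, Nat.add_zero, Nat.zero_add, BinOp.eval_mod, BinOp.eval_eq, BinOp.eval_band,
    BinOp.eval_shr, BinOp.eval_div, BinOp.eval_lt, BinOp.eval_add_of_lt, BinOp.eval_sub_of_le,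
    BinOp.eval_mul_of_lt, h17, h18, h25, h29, h43, h44] at hv3 hR
  have htmp := execOps_cons_fwd hR; clear hR; obtain ⟨v4, hv4, hR⟩ := htmp
  simp -failIfUnchanged (disch := omega) only [Operand.write, Operand.read, merge_apply_of_lt,
    merge_apply_of_le, Function.update_self, Function.update_of_ne, update_merge_of_lt,
    update_merge_of_le, Nat.add_zero, Nat.zero_add, BinOp.eval_mod, BinOp.eval_eq, BinOp.eval_band,
    BinOp.eval_shr, BinOp.eval_div, BinOp.eval_lt, BinOp.eval_add_of_lt, BinOp.eval_sub_of_le,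
    BinOp.eval_mul_of_lt, h17, h18, h25, h29, h43, h44] at hv4 hR
  have htmp := execOps_cons_fwd hR; clear hR; obtain ⟨v5, hv5, hR⟩ := htmp
  simp -failIfUnchanged (disch := omega) only [Operand.write, Operand.read, merge_apply_of_lt,
    merge_apply_of_le, Function.update_self, Function.update_of_ne, update_merge_of_lt,
    update_merge_of_le, Nat.add_zero, Nat.zero_add, BinOp.eval_mod, BinOp.eval_eq, BinOp.eval_band,
    BinOp.eval_shr, BinOp.eval_div, BinOp.eval_lt, BinOp.eval_add_of_lt, BinOp.eval_sub_of_le,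
    BinOp.eval_mul_of_lt, h17, h18, h25, h29, h43, h44] at hv5 hR
  simp only [execOps_nil] at hR; subst hR
  subst hv5 hv4 hv3 hv2 hv1
  refine ⟨_, rfl, fun i hi => ?_, ?_, ?_, ?_, ?_, ?_⟩
  · simp only [Function.update_of_ne, ne_eq, not_false_eq_true, show i ≠ 60 by omega,
      show i ≠ 61 by omega, show i ≠ 62 by omega, show i ≠ 63 by omega, show i ≠ 64 by omega]
  all_goals simp [Function.update_of_ne, Function.update_self]

/-- **`tripleOps3`**: the full window and the count of `buildT`. [folklore] -/
theorem tripleOps3_spec {w : ℕ} {O : List ℕ → List ℕ} {c n F pX : ℕ} {S H : ℕ → ℕ} {qs : List (List ℕ)}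
    (hR : Regs c n F pX S) (hcapW : F + wspNT n < 2 ^ w) :
    ∃ st', Exec w O (block tripleOps3) ⟨merge S H, qs⟩ st' 5 ∧ ∃ S', st' = ⟨merge S' H, qs⟩ ∧
      (∀ i, i < 46 ∨ 50 < i → S' i = S i) ∧
      S' 46 = 0 ∧ S' 47 = 0 ∧ S' 48 = 0 ∧ S' 49 = 0 ∧ S' 50 = cL n * cL n := by
  have h29 := hR.r29
  have hwsp : wspNT n = 2 * (n * n) + 9 * (cL n * cL n) + 3 := rfl
  have hLL' : cL n ≤ cL n * cL n := Nat.le_mul_self _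
  have hnn' : n ≤ n * n := Nat.le_mul_self _
  refine Exec.block_of_fwd _ _ fun R hR => ?_
  unfold tripleOps3 at hR
  have htmp := execOps_cons_fwd hR; clear hR; obtain ⟨v1, hv1, hR⟩ := htmp
  simp -failIfUnchanged (disch := omega) only [Operand.write, Operand.read, merge_apply_of_lt,
    merge_apply_of_le, Function.update_self, Function.update_of_ne, update_merge_of_lt,
    update_merge_of_le, Nat.add_zero, Nat.zero_add, BinOp.eval_mod, BinOp.eval_eq, BinOp.eval_band,
    BinOp.eval_shr, BinOp.eval_div, BinOp.eval_lt, BinOp.eval_add_of_lt, BinOp.eval_sub_of_le,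
    BinOp.eval_mul_of_lt, h29] at hv1 hR
  have htmp := execOps_cons_fwd hR; clear hR; obtain ⟨v2, hv2, hR⟩ := htmp
  simp -failIfUnchanged (disch := omega) only [Operand.write, Operand.read, merge_apply_of_lt,
    merge_apply_of_le, Function.update_self, Function.update_of_ne, update_merge_of_lt,
    update_merge_of_le, Nat.add_zero, Nat.zero_add, BinOp.eval_mod, BinOp.eval_eq, BinOp.eval_band,
    BinOp.eval_shr, BinOp.eval_div, BinOp.eval_lt, BinOp.eval_add_of_lt, BinOp.eval_sub_of_le,
    BinOp.eval_mul_of_lt, h29] at hv2 hR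
  have htmp := execOps_cons_fwd hR; clear hR; obtain ⟨v3, hv3, hR⟩ := htmp
  simp -failIfUnchanged (disch := omega) only [Operand.write, Operand.read, merge_apply_of_lt,
    merge_apply_of_le, Function.update_self, Function.update_of_ne, update_merge_of_lt,
    update_merge_of_le, Nat.add_zero, Nat.zero_add, BinOp.eval_mod, BinOp.eval_eq, BinOp.eval_band,
    BinOp.eval_shr, BinOp.eval_div, BinOp.eval_lt, BinOp.eval_add_of_lt, BinOp.eval_sub_of_le,
    BinOp.eval_mul_of_lt, h29] at hv3 hR
  have htmp := execOps_cons_fwd hR; clear hR; obtain ⟨v4, hv4, hR⟩ := htmp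
  simp -failIfUnchanged (disch := omega) only [Operand.write, Operand.read, merge_apply_of_lt,
    merge_apply_of_le, Function.update_self, Function.update_of_ne, update_merge_of_lt,
    update_merge_of_le, Nat.add_zero, Nat.zero_add, BinOp.eval_mod, BinOp.eval_eq, BinOp.eval_band,
    BinOp.eval_shr, BinOp.eval_div, BinOp.eval_lt, BinOp.eval_add_of_lt, BinOp.eval_sub_of_le,
    BinOp.eval_mul_of_lt, h29] at hv4 hR
  have htmp := execOps_cons_fwd hR; clear hR; obtain ⟨v5, hv5, hR⟩ := htmp
  simp -failIfUnchanged (disch := omega) only [Operand.write, Operand.read, merge_apply_of_lt,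
    merge_apply_of_le, Function.update_self, Function.update_of_ne, update_merge_of_lt,
    update_merge_of_le, Nat.add_zero, Nat.zero_add, BinOp.eval_mod, BinOp.eval_eq, BinOp.eval_band,
    BinOp.eval_shr, BinOp.eval_div, BinOp.eval_lt, BinOp.eval_add_of_lt, BinOp.eval_sub_of_le,
    BinOp.eval_mul_of_lt, h29] at hv5 hR
  simp only [execOps_nil] at hR; subst hR
  subst hv5 hv4 hv3 hv2 hv1
  refine ⟨_, rfl, fun i hi => ?_, ?_, ?_, ?_, ?_, ?_⟩
  · simp only [Function.update_of_ne, ne_eq, not_false_eq_true, show i ≠ 46 by omega,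
      show i ≠ 47 by omega, show i ≠ 48 by omega, show i ≠ 49 by omega, show i ≠ 50 by omega]
  all_goals simp [Function.update_of_ne, Function.update_self]

/-- **`cellOps`**: cell `e = r45 - 1`, the single-cell window `(iv, iu) = (e / L, e % L)` and the
count of `buildT`. [folklore] -/
theorem cellOps_spec {w : ℕ} {O : List ℕ → List ℕ} {c n F pX cl : ℕ} {S H : ℕ → ℕ} {qs : List (List ℕ)}
    (hR : Regs c n F pX S) (h45 : S 45 = cl + 1) (hcl : cl < cL n * cL n) (hcapW : F + wspNT n < 2 ^ w) :
    ∃ st', Exec w O (block cellOps) ⟨merge S H, qs⟩ st' 6 ∧ ∃ S', st' = ⟨merge S' H, qs⟩ ∧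
      (∀ i, i < 45 ∨ 50 < i → S' i = S i) ∧
      S' 45 = cl ∧ S' 46 = 1 ∧ S' 47 = cl / cL n ∧ S' 48 = 1 ∧ S' 49 = cl % cL n ∧
      S' 50 = cL n * cL n := by
  have h25 := hR.r25; have h29 := hR.r29
  have hwsp : wspNT n = 2 * (n * n) + 9 * (cL n * cL n) + 3 := rfl
  have hLL' : cL n ≤ cL n * cL n := Nat.le_mul_self _
  have hnn' : n ≤ n * n := Nat.le_mul_self _
  refine Exec.block_of_fwd _ _ fun R hR => ?_
  unfold cellOps at hR
  have htmp := execOps_cons_fwd hR; clear hR; obtain ⟨v1, hv1, hR⟩ := htmp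
  simp -failIfUnchanged (disch := omega) only [Operand.write, Operand.read, merge_apply_of_lt,
    merge_apply_of_le, Function.update_self, Function.update_of_ne, update_merge_of_lt,
    update_merge_of_le, Nat.add_zero, Nat.zero_add, BinOp.eval_mod, BinOp.eval_eq, BinOp.eval_band,
    BinOp.eval_shr, BinOp.eval_div, BinOp.eval_lt, BinOp.eval_add_of_lt, BinOp.eval_sub_of_le,
    BinOp.eval_mul_of_lt, h25, h29, h45] at hv1 hR
  simp only [Nat.add_sub_cancel] at hv1; subst hv1
  have htmp := execOps_cons_fwd hR; clear hR; obtain ⟨v2, hv2, hR⟩ := htmp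
  simp -failIfUnchanged (disch := omega) only [Operand.write, Operand.read, merge_apply_of_lt,
    merge_apply_of_le, Function.update_self, Function.update_of_ne, update_merge_of_lt,
    update_merge_of_le, Nat.add_zero, Nat.zero_add, BinOp.eval_mod, BinOp.eval_eq, BinOp.eval_band,
    BinOp.eval_shr, BinOp.eval_div, BinOp.eval_lt, BinOp.eval_add_of_lt, BinOp.eval_sub_of_le,
    BinOp.eval_mul_of_lt, h25, h29, h45] at hv2 hR
  have htmp := execOps_cons_fwd hR; clear hR; obtain ⟨v3, hv3, hR⟩ := htmp
  simp -failIfUnchanged (disch := omega) only [Operand.write, Operand.read, merge_apply_of_lt,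
    merge_apply_of_le, Function.update_self, Function.update_of_ne, update_merge_of_lt,
    update_merge_of_le, Nat.add_zero, Nat.zero_add, BinOp.eval_mod, BinOp.eval_eq, BinOp.eval_band,
    BinOp.eval_shr, BinOp.eval_div, BinOp.eval_lt, BinOp.eval_add_of_lt, BinOp.eval_sub_of_le,
    BinOp.eval_mul_of_lt, h25, h29, h45] at hv3 hR
  have htmp := execOps_cons_fwd hR; clear hR; obtain ⟨v4, hv4, hR⟩ := htmp
  simp -failIfUnchanged (disch := omega) only [Operand.write, Operand.read, merge_apply_of_lt,
    merge_apply_of_le, Function.update_self, Function.update_of_ne, update_merge_of_lt,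
    update_merge_of_le, Nat.add_zero, Nat.zero_add, BinOp.eval_mod, BinOp.eval_eq, BinOp.eval_band,
    BinOp.eval_shr, BinOp.eval_div, BinOp.eval_lt, BinOp.eval_add_of_lt, BinOp.eval_sub_of_le,
    BinOp.eval_mul_of_lt, h25, h29, h45] at hv4 hR
  have htmp := execOps_cons_fwd hR; clear hR; obtain ⟨v5, hv5, hR⟩ := htmp
  simp -failIfUnchanged (disch := omega) only [Operand.write, Operand.read, merge_apply_of_lt,
    merge_apply_of_le, Function.update_self, Function.update_of_ne, update_merge_of_lt,
    update_merge_of_le, Nat.add_zero, Nat.zero_add, BinOp.eval_mod, BinOp.eval_eq, BinOp.eval_band,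
    BinOp.eval_shr, BinOp.eval_div, BinOp.eval_lt, BinOp.eval_add_of_lt, BinOp.eval_sub_of_le,
    BinOp.eval_mul_of_lt, h25, h29, h45] at hv5 hR
  have htmp := execOps_cons_fwd hR; clear hR; obtain ⟨v6, hv6, hR⟩ := htmp
  simp -failIfUnchanged (disch := omega) only [Operand.write, Operand.read, merge_apply_of_lt,
    merge_apply_of_le, Function.update_self, Function.update_of_ne, update_merge_of_lt,
    update_merge_of_le, Nat.add_zero, Nat.zero_add, BinOp.eval_mod, BinOp.eval_eq, BinOp.eval_band,
    BinOp.eval_shr, BinOp.eval_div, BinOp.eval_lt, BinOp.eval_add_of_lt, BinOp.eval_sub_of_le,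
    BinOp.eval_mul_of_lt, h25, h29, h45] at hv6 hR
  simp only [execOps_nil] at hR; subst hR
  subst hv6 hv5 hv4 hv3 hv2
  refine ⟨_, rfl, fun i hi => ?_, ?_, ?_, ?_, ?_, ?_, ?_⟩
  · simp only [Function.update_of_ne, ne_eq, not_false_eq_true, show i ≠ 45 by omega,
      show i ≠ 46 by omega, show i ≠ 47 by omega, show i ≠ 48 by omega, show i ≠ 49 by omega,
      show i ≠ 50 by omega]
  all_goals simp [Function.update_of_ne, Function.update_self]

/-- **`markOps`**: `fd[(bi L + iv) n + (bj L + iu)] := pw` for an in-range pair. [folklore] -/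
theorem markOps_spec {w : ℕ} {O : List ℕ → List ℕ} {c n F pX pw bi bj iv iu : ℕ} {S H : ℕ → ℕ}
    {qs : List (List ℕ)}
    (hR : Regs c n F pX S) (h40 : S 40 = pw) (h42 : S 42 = bi) (h43 : S 43 = bj) (h47 : S 47 = iv)
    (h49 : S 49 = iu) (hi : bi * cL n + iv < n) (hj : bj * cL n + iu < n) (hF : 100 ≤ F)
    (hpw : pw < 2 ^ w) (hcapW : F + wspNT n < 2 ^ w) (hcapN : (n + cL n) * n + (n + cL n) < 2 ^ w) :
    ∃ st', Exec w O (block markOps) ⟨merge S H, qs⟩ st' 8 ∧ ∃ S', st' = ⟨merge S'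
      (Function.update H (F + n * n + ((bi * cL n + iv) * n + (bj * cL n + iu))) pw), qs⟩ ∧
      (∀ i, i < 51 ∨ 52 < i → S' i = S i) := by
  have h2 := hR.r2; have h25 := hR.r25; have h30 := hR.r30
  have hwsp : wspNT n = 2 * (n * n) + 9 * (cL n * cL n) + 3 := rfl
  have hLL' : cL n ≤ cL n * cL n := Nat.le_mul_self _
  have hnn' : n ≤ n * n := Nat.le_mul_self _
  have hidx : (bi * cL n + iv) * n + (bj * cL n + iu) < n * n := NegTriToAPSP.mul_add_lt_mul hi hj
  have hp : (bi * cL n + iv) * n ≤ (n + cL n) * n := Nat.mul_le_mul_right _ (by omega)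
  refine Exec.block_of_fwd _ _ fun R hR => ?_
  unfold markOps at hR
  have htmp := execOps_cons_fwd hR; clear hR; obtain ⟨v1, hv1, hR⟩ := htmp
  simp -failIfUnchanged (disch := omega) only [Operand.write, Operand.read, merge_apply_of_lt,
    merge_apply_of_le, Function.update_self, Function.update_of_ne, update_merge_of_lt,
    update_merge_of_le, Nat.add_zero, Nat.zero_add, BinOp.eval_mod, BinOp.eval_eq, BinOp.eval_band,
    BinOp.eval_shr, BinOp.eval_div, BinOp.eval_lt, BinOp.eval_add_of_lt, BinOp.eval_sub_of_le,
    BinOp.eval_mul_of_lt, h2, h25, h30, h40, h42, h43, h47, h49] at hv1 hR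
  subst hv1
  have htmp := execOps_cons_fwd hR; clear hR; obtain ⟨v2, hv2, hR⟩ := htmp
  simp -failIfUnchanged (disch := omega) only [Operand.write, Operand.read, merge_apply_of_lt,
    merge_apply_of_le, Function.update_self, Function.update_of_ne, update_merge_of_lt,
    update_merge_of_le, Nat.add_zero, Nat.zero_add, BinOp.eval_mod, BinOp.eval_eq, BinOp.eval_band,
    BinOp.eval_shr, BinOp.eval_div, BinOp.eval_lt, BinOp.eval_add_of_lt, BinOp.eval_sub_of_le,
    BinOp.eval_mul_of_lt, h2, h25, h30, h40, h42, h43, h47, h49] at hv2 hR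
  subst hv2
  have htmp := execOps_cons_fwd hR; clear hR; obtain ⟨v3, hv3, hR⟩ := htmp
  simp -failIfUnchanged (disch := omega) only [Operand.write, Operand.read, merge_apply_of_lt,
    merge_apply_of_le, Function.update_self, Function.update_of_ne, update_merge_of_lt,
    update_merge_of_le, Nat.add_zero, Nat.zero_add, BinOp.eval_mod, BinOp.eval_eq, BinOp.eval_band,
    BinOp.eval_shr, BinOp.eval_div, BinOp.eval_lt, BinOp.eval_add_of_lt, BinOp.eval_sub_of_le,
    BinOp.eval_mul_of_lt, h2, h25, h30, h40, h42, h43, h47, h49] at hv3 hR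
  subst hv3
  have htmp := execOps_cons_fwd hR; clear hR; obtain ⟨v4, hv4, hR⟩ := htmp
  simp -failIfUnchanged (disch := omega) only [Operand.write, Operand.read, merge_apply_of_lt,
    merge_apply_of_le, Function.update_self, Function.update_of_ne, update_merge_of_lt,
    update_merge_of_le, Nat.add_zero, Nat.zero_add, BinOp.eval_mod, BinOp.eval_eq, BinOp.eval_band,
    BinOp.eval_shr, BinOp.eval_div, BinOp.eval_lt, BinOp.eval_add_of_lt, BinOp.eval_sub_of_le,
    BinOp.eval_mul_of_lt, h2, h25, h30, h40, h42, h43, h47, h49] at hv4 hR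
  subst hv4
  have htmp := execOps_cons_fwd hR; clear hR; obtain ⟨v5, hv5, hR⟩ := htmp
  simp -failIfUnchanged (disch := omega) only [Operand.write, Operand.read, merge_apply_of_lt,
    merge_apply_of_le, Function.update_self, Function.update_of_ne, update_merge_of_lt,
    update_merge_of_le, Nat.add_zero, Nat.zero_add, BinOp.eval_mod, BinOp.eval_eq, BinOp.eval_band,
    BinOp.eval_shr, BinOp.eval_div, BinOp.eval_lt, BinOp.eval_add_of_lt, BinOp.eval_sub_of_le,
    BinOp.eval_mul_of_lt, h2, h25, h30, h40, h42, h43, h47, h49] at hv5 hR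
  subst hv5
  have htmp := execOps_cons_fwd hR; clear hR; obtain ⟨v6, hv6, hR⟩ := htmp
  simp -failIfUnchanged (disch := omega) only [Operand.write, Operand.read, merge_apply_of_lt,
    merge_apply_of_le, Function.update_self, Function.update_of_ne, update_merge_of_lt,
    update_merge_of_le, Nat.add_zero, Nat.zero_add, BinOp.eval_mod, BinOp.eval_eq, BinOp.eval_band,
    BinOp.eval_shr, BinOp.eval_div, BinOp.eval_lt, BinOp.eval_add_of_lt, BinOp.eval_sub_of_le,
    BinOp.eval_mul_of_lt, h2, h25, h30, h40, h42, h43, h47, h49] at hv6 hR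
  subst hv6
  have htmp := execOps_cons_fwd hR; clear hR; obtain ⟨v7, hv7, hR⟩ := htmp
  simp -failIfUnchanged (disch := omega) only [Operand.write, Operand.read, merge_apply_of_lt,
    merge_apply_of_le, Function.update_self, Function.update_of_ne, update_merge_of_lt,
    update_merge_of_le, Nat.add_zero, Nat.zero_add, BinOp.eval_mod, BinOp.eval_eq, BinOp.eval_band,
    BinOp.eval_shr, BinOp.eval_div, BinOp.eval_lt, BinOp.eval_add_of_lt, BinOp.eval_sub_of_le,
    BinOp.eval_mul_of_lt, h2, h25, h30, h40, h42, h43, h47, h49] at hv7 hR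
  subst hv7
  have htmp := execOps_cons_fwd hR; clear hR; obtain ⟨v8, hv8, hR⟩ := htmp
  simp -failIfUnchanged (disch := omega) only [Operand.write, Operand.read, merge_apply_of_lt,
    merge_apply_of_le, Function.update_self, Function.update_of_ne, update_merge_of_lt,
    update_merge_of_le, Nat.add_zero, Nat.zero_add, BinOp.eval_mod, BinOp.eval_eq, BinOp.eval_band,
    BinOp.eval_shr, BinOp.eval_div, BinOp.eval_lt, BinOp.eval_add_of_lt, BinOp.eval_sub_of_le,
    BinOp.eval_mul_of_lt, h2, h25, h30, h40, h42, h43, h47, h49] at hv8 hR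
  simp only [execOps_nil] at hR; subst hR
  subst hv8
  rw [show (bi * cL n + iv) * n + (bj * cL n + iu) + (F + n * n) =
    F + n * n + ((bi * cL n + iv) * n + (bj * cL n + iu)) by omega]
  refine ⟨_, rfl, fun i hi => ?_⟩
  simp only [Function.update_of_ne, ne_eq, not_false_eq_true, show i ≠ 51 by omega, show i ≠ 52 by omega]

/-! ## The query -/

/-- **`ask`**: the oracle is queried on the `QLEN` words from `QB`; its answer is written at `AB`
and the query is logged. [folklore] -/
theorem ask_exec {w : ℕ} {O : List ℕ → List ℕ} {c n F pX : ℕ} {S H : ℕ → ℕ} {qs : List (List ℕ)}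
    (hR : Regs c n F pX S) (hF : 100 ≤ F) :
    Exec w O ask ⟨merge S H, qs⟩
      ⟨merge S (segWrite H (F + 2 * (n * n) + (9 * (cL n * cL n) + 1))
        ((O (readSeg H (F + 2 * (n * n)) (9 * (cL n * cL n) + 1))).map (· % 2 ^ w))),
        qs ++ [readSeg H (F + 2 * (n * n)) (9 * (cL n * cL n) + 1)]⟩ 1 := by
  have := Exec.query_dir (w := w) (O := O) (qa := 31) (ql := 28) (aa := 32) (by norm_num) (by norm_num)
    (by norm_num) (S := S) (by rw [hR.r31]; omega) (by rw [hR.r32]; omega) H qs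
  rw [hR.r31, hR.r28, hR.r32] at this
  exact this

end Literature.Computability.FineGrained.NegTriSweep
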